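import Summits.FinalStateConjecture.FinalStateConjecture.Theses.ZeroEnergyKerrOrBomb
import Literature.Geometry.Lorentzian.TrivialDataAdmissible
import Summits.FinalStateConjecture.FinalStateConjecture.Theorems.TameCensorship.Negative.GenericityAndFails
import Literature.Geometry.Lorentzian.StationaryFinalStateDecomposition
import Literature.Geometry.Lorentzian.ExteriorRegionSchwarzschildEnd
import Literature.Geometry.Lorentzian.KerrDataProofs
import Literature.Geometry.Lorentzian.KerrSchildCoord
import Literature.Geometry.Lorentzian.LeviCivitaProofs

/-!
# Disproof of `StationaryLimitReduction` — findings (cdisprove seat, cycles 1–4, 2026-08-16)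

Crux (item stmt-FinalStateConjecture-10021, route ZeroEnergyKerrOrBomb, rank 4):
`StationaryLimitReduction : Prop := KerrOrBomb → FinalStateConjecture`.

## Verdict of this cycle: NO KILL — and why it resists

* `not_crux_iff` : `¬ StationaryLimitReduction ↔ (KerrOrBomb ∧ ¬ FinalStateConjecture)`.
  A disproof must (i) PROVE the route's target `KerrOrBomb` (smooth stationary vacuum
  rigidity for mode-stable holes — as typed, hypothesis h3 `IsNonDegenerateHorizon` hands a
  GLOBAL Killing field null on `𝓔⁺`, cf. Cruxes/ZeroEnergyRigidity/TRIAGE-r1-1.md (D-h3), so the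
  typed target is two-Killing-field uniqueness modulo `I⁺`-regularity — still far outside the
  tree) AND (ii) REFUTE the audited summit statement. Neither leg is available:
  - leg (i): `KerrOrBomb` is not vacuous — its telescope (Ricci-flat, connected non-degenerate
    horizon, globally hyperbolic carrier, `T ≠ 0` on the d.o.c., Killing-mode-stable) is modelled
    by every subextremal Kerr (`Kerr.spacetime M a r₀`, `r₋ < r₀ < r₊`; mode stability = Whiting
    1989), and its instance hypotheses are consistent: `HasLeviCivita` holds outright
    (`PseudoRiemannianMetric.hasLeviCivita`), `Kerr.Facts` are true analytic facts. Mutilation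
    tricks (strut-deleted multi-hole Weyl/double-Kerr solutions, horizon-deleted carriers) are
    killed by `IsGloballyHyperbolic` of the whole carrier; so no junk counter-model and no junk
    proof of the target is in sight.
  - leg (ii): admissible data EXIST (`trivialData_mem_admissibleVacuumData`, PROVED in tree), so
    `¬ FinalStateConjecture` ⇔ some admissible datum failing the summit property `P` admits no
    admissible curve of good data through it. No individual MGHD is constructible in the tree
    (MGHD existence is the named fact `choquetBruhat_geroch_exists_mghd_cauchy`; maximality of
    Minkowski over flat data is not proved), so the only ¬FSC proof conceivable today is a
    UNIFORM junk failure of `P` (`not_summit_of_forall_not`). I re-read the four conjuncts of `P`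
    for junk (CauchyDevelopment.lean, NullInfinity.lean `HasCompleteFutureNullInfinity` sojourn
    form, KerrConvergence.lean `FinalStateDecomposition`, Statement.lean `HasExhaustiveCharts`,
    FinalState.lean `exteriorOf`): each is satisfied by the expected geometry (Minkowski `N = 0`:
    complete `𝓘⁺` via `hasCompleteFutureNullInfinity_of_isNullGeodesicallyComplete`; exhaustive
    flat chart = identity on `{x⁰ > τ₀}`), consistent with audit g6. No uniform failure found.
* Consequently the crux is, in every plausible world, EQUIVALENT to the summit
  (`crux_iff_summit_of_target`): it carries weak cosmic censorship, MGHD settling and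
  genericity transfer. It is a "reduction" only nominally — the planner says as much
  ([difficulty: open-problem]). This is information for the lead, not a refutation.

## Contents
* §1 logical skeleton (`crux_iff`, `not_crux_iff`, `crux_of_summit`, `crux_of_not_target`,
  `crux_iff_summit_of_target`).
* §2 load-bearing analysis: the crux has ONE hypothesis; dropping it gives the summit itself
  (`StationaryLimitReductionWithoutKerrOrBomb`, `without_iff_summit`) — no `_false_without_`
  theorem can exist short of `¬ FinalStateConjecture`.
* §3 the summit unfolded (`SummitProperty`, `summit_iff`) and the ONLY shape a kill can take in
  this tree: `not_summit_of_forall_not`, `not_summit_of_forall_not_slice`, `not_crux_of`.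
* §4 natural strengthenings: the pointwise (non-generic) reduction
  `StationaryLimitReductionPointwise` implies the crux (`crux_of_pointwise`); it is BELIEVED
  false because genericity is load-bearing in the summit — threshold (critical-collapse) data are
  expected to form naked singularities (vacuum: numerical, Abrahams–Evans 1993), third-law
  violating data to form exactly extremal holes (`|a| = M` breaks `IsSubextremal`; proved for
  Einstein–Maxwell-charged scalar fields by Kehle–Unger 2022, conjectured in vacuum), and the
  Rodnianski–Shlapentokh-Rothman vacuum naked singularities (Ann. Math. 198 (2023); interior:
  arXiv:2204.09891) have incomplete `𝓘⁺` but finite regularity across the past cone — so NO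
  smooth admissible vacuum counterexample datum is rigorously known, let alone constructible here;
  recorded as definitions, nothing claimed. (`lit search` was unavailable, rc 75, when this was
  written: citations from memory, to be re-checked.)
* §5 obstruction to the foreseen layer-2 split (SettlesToStationary → GenericityTransfer →
  KerrChartTransfer): Christodoulou curve-genericity is NOT closed under conjunction
  (`genericity_not_and_closed`, re-exporting TameCensorship/Negative
  `not_isChristodoulouGeneric_and_closed`): separately generic "complete 𝓘⁺", "settles to a
  stationary family" and "the limit is mode-stable" do not glue by logic — one admissible curve
  must escape all exceptional sets at once.
* Landed: `Theorems/StationaryLimitReduction/Negative/KillShape.lean` (p72863; §1/§3 without defs);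
  `Theorems/StationaryLimitReduction/Negative/FarFieldFocusing.lean` (p76008, cycle 2: §7's checked
  lemmas `focusing_exponents`, `centre_value_eq_two_deriv`, `not_tendsto_(trunc)deviationCk_of_frequently_le`,
  `isChristodoulouGeneric_of/iff_escape`, `finalStateConjecture_of_escape`).
* `-- Targets`: none in cycle 1 (payload.targets = []).
* §7 (CYCLE 2, 2026-08-16): FAR-FIELD FOCUSING PACKETS. Admissibility controls `(2,1)` weighted
  derivatives of `(h,k)` at `i⁰`; the summit asks `C²` convergence; incoming packets focusing at
  late events gain one power of the frequency (`centre_value_eq_two_deriv`, `focusing_exponents`),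
  so `|Riem| → ∞` at events `qₙ → i⁺` inside every MGHD of `D + packets`, for EVERY admissible `D`:
  the POINTWISE summit property fails on a DR-dense set (`not_finalStatePointwise`, near-miss with
  `sorry`; checked last step `not_tendsto_(trunc)deviationCk_of_frequently_le`), the summit is
  rescued only by ESCAPE along admissible curves (`isChristodoulouGeneric_iff_escape`,
  `summit_of_pointwiseOn_of_escape`), and every pointwise capture/settling stub of this crux must
  carry far-field regularity `(3,2)`+ of the datum or be generic. Corrects hub note
  HonestFixedRadiusSettling/NegativeNotes-far-field-dust (B1 "k = 2 protected": not against foci).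
* §8 `-- Targets` (cycle 2): skeleton `kerr-avoidance-dichotomy` (5 stubs) READ: T1 STUB-MISSTATED
  `IsTame.telescope` — cluster membership is profile-only (`mem_cluster_iff`), the telescope clause is
  host-level; a mutilated-Kerr junk twin of any Kerr cluster profile is in the cluster and is not globally
  hyperbolic, so tameness forces `N = 0`, `KerrAvoiding`/`BombLimited` are false, S3/S5 vacuous, S4 trivial and
  S1 false as typed (`forall_host_fails_of_bad_twin`; repair R1/R2 given); T2 S4 survives focusing (owed by
  S1, which lacks a far-field regularisation cut); T3/T4 remarks on S2/S3.
* §9 `-- Targets` (CYCLE 3, 2026-08-16T03Z): the lead PICKED `one-locked-explosion` (7 stubs). T5 stub 1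
  `stub_localEscapeSuffices` PROVED (evidence file `Stub1LocalEscapeSuffices.lean`, verbatim quote). T6 STUB-MISSTATED
  `IsExplosionExit` (interface stub 6 → 7): its non-triviality clause (iii) is unrestricted in chart time and gauge-dependent,
  so an MGHD that is EXACTLY `𝓑` on every early leaf plus a reparametrisation wiggle is an "explosion exit" at EVERY rate
  (`Quote.isExplosionExit_of_exact_early`, kernel); paper witness: the capped Kruskal slice `{U+V=c}` above the bifurcation sphere
  (admissible, GOOD, MGHD ⊇ the whole Schwarzschild/Kerr exterior, no explosion; one non-explicit step: a compact vacuum fill-in);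
  and (c) the intended top-mode explosions CANNOT satisfy (i) ∧ (ii): full early leaves force `ι Y` across the left horizon branch,
  where an `𝓗⁺`-regular growing perturbation is only `C^{⌈ν/κ⌉−1}` (generic rates) — the early near zone of an explosion is never in
  the past development of a one-ended exit slice; and (J, drefuter (E1)(a), confirmed) for NON-Kerr holes `SummitProperty Y e` kills the
  exact-wedge junk by domain of dependence of a full leaf. Hence for the holes stubs 6–7 range over, `IsExplosionExit ∧ SummitProperty`
  is generically UNSATISFIABLE: stub 6 as typed denies the bomb branch ("no such hole") instead of resolving it, stub 7 is vacuous —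
  the line's content has silently become smooth rigidity. Repairs: (R1) gauge-invariant (iii*)
  (`Quote.IsExplosionExitRepaired`, `isExplosionExit_of_repaired` : repaired → original) fixes (a)/(b) but is unsatisfiable by (c);
  (R2) separate the explosion spacetime `𝓔` from the admissible exit datum (data agreeing outside a trapped compact set). T7 typed
  remarks on stubs 2–5.
  Cycle-3 re-audit of both legs of `not_crux_iff` (IsMaximal universal property, smooth `TimeOrientation` fixes the cone class,
  sojourn-form `𝓘⁺`, `IsSoleEnd` = compact complement, `IsIsometricImmersion`, the scalar mode clause) found them faithful: no kill.
* §10 (CYCLE 4, gen-4 seat, 2026-08-16T05Z): fourth audit of both legs by new routes (leg (i): the instance binders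
  `[HasLeviCivita] [Kerr.Facts]` of the target are tree THEOREMS, so no vacuous proof of `KerrOrBomb`; the cheap growing
  scalar "modes" are killed by the boundedness clause; leg (ii): differentiable-curve `IsCauchyHypersurface`, all-rays sojourn
  form, the structure's own `diff_subset_causalPast` — faithful): NO KILL. The drefuter's REPAIR C′ of stubs 6–7
  (`NegativeNotes-OneGoodExplosion.md` §3) is TYPED (`Quote.ExitCore`, `Quote.IsAFVacuumDataWithEnd`, `Quote.IsExplosionExit'`,
  `Quote.GoodFateAlong`), certified to WEAKEN stub 6's conclusion (`Quote.repaired_of_original`, via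
  `AFEnd.exists_radius_far_disjoint`) and attacked before adoption: it keeps the gauge-dependent clause (iii), so the exact-wedge
  junk transposes (`Quote.isExplosionExit'_of_exact_early`) and is excluded only downstream through the rigidity lemma typed as
  `Quote.StationaryGoodFateRigidity` (RIG; `Quote.junk_exit_absurd`), which stub 7′ would silently contain — adopt C′ ∧ R1
  ((iii*) of `Quote.IsExplosionExitRepaired`) or file RIG as a stub; otherwise C′ survives my attacks. Kernel germs for the lock:
  an even flat amplitude is not injective, the odd companion `s e^{-1/s²}` is (`Quote.strictMono_oddFlat`,
  `Quote.injective_lockedCurveParam`), and `Quote.flat_seed_swamped` (`e^{-au²+bu}u^p → 0`) quantifies why far-field modifications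
  along the curve must sit outside the past light cone of the exit (`R(s)s² → ∞`; the skeleton's `e^{2/s²}` passes, `1/|s|` would
  not) while §7 (b) forces SOME far-field modification. §10.5: a planar caricature (`ṡ = −y²`, `ẏ = sy`) of why the crux needs an
  EDGE statement (generic third law) beyond the target and per-bomb repulsion — carried, correctly, by `stub_settleOrEscape` (c).
-/

set_option linter.dupNamespace false

namespace Summit.FinalStateConjecture.FinalStateConjecture.Cruxes.StationaryLimitReduction.Disproof

open Summit.FinalStateConjecture.FinalStateConjecture.Theses.ZeroEnergyKerrOrBomb
open Literature.Geometry.Lorentzian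
open scoped Manifold ContDiff Topology ENNReal
open Filter

/-! ## §1 Logical skeleton -/

/-- The crux is literally the implication target → summit. -/
theorem crux_iff : StationaryLimitReduction ↔ (KerrOrBomb → _root_.FinalStateConjecture) :=
  Iff.rfl

/-- WHY IT RESISTS: a disproof of the crux is exactly a proof of the route's target together with
a refutation of the summit statement. -/
theorem not_crux_iff :
    ¬ StationaryLimitReduction ↔ (KerrOrBomb ∧ ¬ _root_.FinalStateConjecture) :=
  Classical.not_imp

/-- The crux follows from the summit (so it is at most as hard as the summit). -/
theorem crux_of_summit (h : _root_.FinalStateConjecture) : StationaryLimitReduction :=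
  fun _ ↦ h

/-- The crux follows from the negation of the target (a refutation of `KerrOrBomb` — e.g. a smooth
mode-stable non-Kerr vacuum hole, 'dark hair' — would close this item trivially and break the
route at its target instead). -/
theorem crux_of_not_target (h : ¬ KerrOrBomb) : StationaryLimitReduction :=
  fun hX ↦ absurd hX h

/-- Once the route has proved its target (its whole point), the crux IS the summit. -/
theorem crux_iff_summit_of_target (hX : KerrOrBomb) :
    StationaryLimitReduction ↔ _root_.FinalStateConjecture :=
  ⟨fun h ↦ h hX, fun h _ ↦ h⟩

/-- The crux is equivalent to the disjunction "target false or summit true". -/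
theorem crux_iff_or : StationaryLimitReduction ↔ (¬ KerrOrBomb ∨ _root_.FinalStateConjecture) :=
  imp_iff_not_or

/-! ## §2 Load-bearing analysis

The crux has a single hypothesis, `KerrOrBomb`. Dropping it leaves the summit statement itself, so
"any proof must use `KerrOrBomb`" cannot be certified by a `_false_without_` theorem unless the
summit is refuted. Recorded as a definition + `Iff.rfl`. -/

/-- The crux with its only hypothesis dropped: the summit. -/
def StationaryLimitReductionWithoutKerrOrBomb : Prop := _root_.FinalStateConjecture

/-- Dropping `KerrOrBomb` from the crux gives exactly `FinalStateConjecture`. -/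
theorem without_iff_summit :
    StationaryLimitReductionWithoutKerrOrBomb ↔ _root_.FinalStateConjecture := Iff.rfl

/-- … hence `¬ StationaryLimitReductionWithoutKerrOrBomb` would be a refutation of the summit. -/
theorem not_without_iff : ¬ StationaryLimitReductionWithoutKerrOrBomb ↔ ¬ _root_.FinalStateConjecture :=
  Iff.rfl

/-! ## §3 The summit unfolded, and the only available shape of a kill -/

/-- The property `P(D)` the summit asserts generically of admissible data `D` on the slice `X`
(verbatim the lambda of `FinalStateConjecture`): an MGHD exists, and every MGHD has complete `𝓘⁺`
and an exhaustive sub-extremal `N`-Kerr final-state decomposition of its self-determined exterior. -/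
def SummitProperty (X : Type) [TopologicalSpace X] [ChartedSpace E3 X] [IsManifold (𝓡 3) ∞ X]
    [T2Space X] [SecondCountableTopology X] [ConnectedSpace X] (D : InitialDataSet (𝓡 3) X) :
    Prop :=
  (∃ 𝒟 : VacuumCauchyDevelopment D, 𝒟.IsMaximal) ∧
    ∀ 𝒟 : VacuumCauchyDevelopment D, 𝒟.IsMaximal →
      Summit.FinalStateConjecture.HasCompleteNullInfinity 𝒟.toCauchyDevelopment ∧
        ∃ (O : Set 𝒟.carrier) (d : FinalStateDecomposition 𝒟.toSpacetime O 2),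
          (∀ i, Kerr.IsSubextremal (d.mass i) (d.spin i)) ∧
            O = Summit.FinalStateConjecture.exteriorOf 𝒟.toCauchyDevelopment d.charted ∧
              Summit.FinalStateConjecture.HasExhaustiveCharts d

/-- The summit, unfolded: Christodoulou-genericity (codimension 1) of `SummitProperty` inside the
admissible class, for every connected Hausdorff second-countable smooth 3-manifold. -/
theorem summit_iff :
    _root_.FinalStateConjecture ↔
      ∀ (X : Type) [TopologicalSpace X] [ChartedSpace E3 X] [IsManifold (𝓡 3) ∞ X] [T2Space X]
        [SecondCountableTopology X] [ConnectedSpace X],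
        InitialDataSet.IsChristodoulouGeneric (admissibleVacuumData X) (SummitProperty X) 1 :=
  Iff.rfl

/-- A nonzero parameter in `ℝ¹`. -/
private lemma exists_ne_zero_param : ∃ c : EuclideanSpace ℝ (Fin 1), c ≠ 0 :=
  ⟨EuclideanSpace.single 0 1, fun h ↦ by simpa using congrArg (fun v : EuclideanSpace ℝ (Fin 1) ↦ v 0) h⟩

/-- THE ONLY SHAPE OF A KILL OF THE SUMMIT AVAILABLE IN THIS TREE: if on some slice `X` carrying an
admissible datum the summit property fails for EVERY admissible datum (a uniform, junk-type
failure of `P`), the summit is false — a genericity family through the bad datum would consist of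
admissible, hence bad, data. (Individual MGHDs are not constructible here, so no finer ¬FSC proof
is conceivable at present.) -/
theorem not_summit_of_forall_not {X : Type} [TopologicalSpace X] [ChartedSpace E3 X]
    [IsManifold (𝓡 3) ∞ X] [T2Space X] [SecondCountableTopology X] [ConnectedSpace X]
    {D : InitialDataSet (𝓡 3) X} (hD : D ∈ admissibleVacuumData X)
    (h : ∀ D' ∈ admissibleVacuumData X, ¬ SummitProperty X D') : ¬ _root_.FinalStateConjecture := by
  intro hF
  obtain ⟨F, -, -, -, hF𝓓, hgood⟩ := hF X D ⟨hD, h D hD⟩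
  obtain ⟨c, hc⟩ := exists_ne_zero_param
  exact hgood c hc ⟨hF𝓓 c, h _ (hF𝓓 c)⟩

/-- Specialisation to the Minkowski slice `ℝ³`, which carries the (proved-admissible) trivial data:
a uniform failure of the summit property on `admissibleVacuumData Minkowski.slice` refutes the
summit. (Expected NOT to hold: `P(trivialData)` is the `N = 0` dispersal statement for Minkowski
space, true modulo the un-constructed maximality of Minkowski as a development.) -/
theorem not_summit_of_forall_not_slice
    (h : ∀ D ∈ admissibleVacuumData Minkowski.slice, ¬ SummitProperty Minkowski.slice D) :
    ¬ _root_.FinalStateConjecture :=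
  not_summit_of_forall_not trivialData_mem_admissibleVacuumData h

/-- The precise shape of the only conceivable kill of THIS crux in the tree: a proof of the target
plus a uniform failure of the summit property on the Minkowski slice. Both inputs are out of reach
(module docstring); recorded so that the lead sees what a refutation would have to contain. -/
theorem not_crux_of (hX : KerrOrBomb)
    (h : ∀ D ∈ admissibleVacuumData Minkowski.slice, ¬ SummitProperty Minkowski.slice D) :
    ¬ StationaryLimitReduction :=
  not_crux_iff.2 ⟨hX, not_summit_of_forall_not_slice h⟩

/-! ## §4 Natural strengthenings -/

/-- The POINTWISE (non-generic) final-state statement: every admissible datum satisfies `P`. -/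
def FinalStatePointwise : Prop :=
  ∀ (X : Type) [TopologicalSpace X] [ChartedSpace E3 X] [IsManifold (𝓡 3) ∞ X] [T2Space X]
    [SecondCountableTopology X] [ConnectedSpace X], ∀ D ∈ admissibleVacuumData X, SummitProperty X D

/-- The pointwise statement implies the summit (empty exceptional set). -/
theorem summit_of_pointwise (h : FinalStatePointwise) : _root_.FinalStateConjecture :=
  fun X _ _ _ _ _ _ ↦ InitialDataSet.isChristodoulouGeneric_of_forall (h X) 1

/-- The pointwise strengthening of the crux: target → every admissible datum settles to
sub-extremal Kerr. BELIEVED false (genericity is load-bearing in the final state conjecture: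
threshold data / critical collapse, exactly-extremal final states breaking `IsSubextremal`,
naked singularities breaking complete `𝓘⁺` — see the module docstring for the status of each
mechanism in the SMOOTH VACUUM admissible class, where no rigorous counterexample datum is known),
and in any case no admissible counterexample datum is constructible in the tree, so it is recorded
as a definition only. -/
def StationaryLimitReductionPointwise : Prop := KerrOrBomb → FinalStatePointwise

/-- The pointwise strengthening implies the crux. -/
theorem crux_of_pointwise (h : StationaryLimitReductionPointwise) : StationaryLimitReduction :=
  fun hX ↦ summit_of_pointwise (h hX)

/-- Conversely a refutation of the pointwise strengthening needs the target AND a bad admissible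
datum — again leg (i) is missing. -/
theorem not_pointwise_iff :
    ¬ StationaryLimitReductionPointwise ↔ (KerrOrBomb ∧ ¬ FinalStatePointwise) :=
  Classical.not_imp

/-! ## §5 Obstruction to the foreseen layer-2 split (cited negative lemma)

The route file foresees `StationaryLimitReduction ⇐ SettlesToStationary → GenericityTransfer →
KerrChartTransfer`, i.e. it intends to intersect several separately Christodoulou-generic
properties of admissible data (complete `𝓘⁺`; settling to a boosted stationary vacuum family;
mode-stability of the limit holes). The tree already proves that curve-genericity of codimension
`≥ 1` is not closed under conjunction — on the Minkowski slice, admissible class `univ`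
(`Theorems/TameCensorship/Negative/GenericityAndFails.lean`). Re-exported verbatim for the lead:
a proof of this crux along that split must exhibit ONE admissible curve through each bad datum
escaping all exceptional sets simultaneously (or switch to an intersection-stable genericity, which
the summit does not use). Caveat: the model families there are not constraint-solving; the same
statement inside `admissibleVacuumData Minkowski.slice` is open in the tree. -/

/-- **Christodoulou curve-genericity is not `∧`-closed** (re-export of
`Theorems.TameCensorship.Negative.not_isChristodoulouGeneric_and_closed`). -/
theorem genericity_not_and_closed :
    ¬ ∀ (𝓓 : Set Theorems.TameCensorship.Negative.SliceData)
        (P Q : Theorems.TameCensorship.Negative.SliceData → Prop),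
        InitialDataSet.IsChristodoulouGeneric 𝓓 P 1 → InitialDataSet.IsChristodoulouGeneric 𝓓 Q 1 →
          InitialDataSet.IsChristodoulouGeneric 𝓓 (fun D ↦ P D ∧ Q D) 1 :=
  Theorems.TameCensorship.Negative.not_isChristodoulouGeneric_and_closed

/-! ## §6 Notes for the lead on the foreseen split (prose; no Lean object exists yet)

* GENERICITY TRANSFER has a typed gap. `KerrOrBomb` measures (in)stability of a stationary hole by
  Killing modes of the SCALAR wave operator `□_g` (`𝓑.metric.dalembertian`), a proxy that is not
  part of the vacuum dynamics. The transfer step "limit hole not Kerr ⇒ (contrapositive of the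
  target) scalar-mode-unstable ⇒ the Einstein-vacuum flow repels all but a positive-codimension set
  of admissible data" therefore needs a lemma `scalar Killing-mode growth on (M, g) ⇒ nonlinear
  vacuum instability of (M, g) as a late-time limit`, which is not known for any background (and
  cannot be tested: no smooth non-Kerr stationary AF vacuum hole is known). A split that files
  GenericityTransfer should either (a) retype mode stability on linearised gravity (Teukolsky /
  linearised Einstein in a gauge), or (b) carry the scalar-to-gravity transfer as its own stub.
* SETTLING needs `StationaryFinalStateDecomposition` limits to be `StationaryAFBlackHole`s with the
  target's telescope: connected NON-DEGENERATE horizon and global hyperbolicity of a carrier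
  containing `𝓗⁺`. Degenerate (extremal) limits are excluded from the target's hypothesis, so the
  split must ALSO prove a dynamical third law generically (cf. crux TameCensorship of route
  PhotonSphereChannels, whose Negative/ files show the three generic clauses do not glue by logic).
* As typed, hypothesis h3 of the target hands a global Killing field null on `𝓔⁺`
  (Cruxes/ZeroEnergyRigidity/TRIAGE-r1-1.md, D-h3); a dynamical limit supplies at best the
  stationary field `T` and a horizon generator, not a second global Killing field — so the settling
  step must produce h3 as typed (i.e. prove Hawking rigidity for the limit) or wait for the
  planner's collar-form restatement. -/

/-! ## §7 Far-field FOCUSING packets (cycle 2): the pointwise summit property is false on a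
DR-dense set of admissible data; what any "settling" sub-crux of this reduction must therefore say

### The mechanism (refuter-level, explicit; scalar model rigorous)

Admissibility (`admissibleVacuumData`, `AFEnd.IsStronglyAsymptoticallyFlatDR`) controls the far
field of a datum to `(n_h, n_k) = (2, 1)` weighted derivatives: `h − (1 + 2M/r)δ = o₂(r⁻¹)`,
`k = o₁(r⁻²)`; higher derivatives are smooth but FREE. The summit property `P(D)`
(`SummitProperty`) demands `C²` (`k = 2`) convergence: `FinalStateDecomposition … 2` with
`tendsto_deviationCk_flat` (sup over whole flat slabs) and, through `HasExhaustiveCharts`,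
`truncDeviationCk … 2 (Rᵢ τ) τ → 0` on growing near zones. These two numbers are mismatched by
exactly one derivative, and FOCUSING exhibits the mismatch:

* Scalar model (exact). On `ℝ¹⁺³` let `ρ = |x − x⋆|` and
  `ψ(t, x) = (f(t − T + ρ) − f(t − T − ρ)) / ρ`, `f(s) = F · χ(ω s)`, `χ ∈ C_c^∞(−1, 1)`.
  This solves `□ψ = 0`; at `t = 0` it is supported on the shell `|ρ − T| ≤ 1/ω`, where
  `|∂^m ψ(0)| ≈ F ω^m / T` and `|∂^m ∂ₜψ(0)| ≈ F ω^{m+1} / T`; at the FOCUS `(T, x⋆)` one has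
  `∂ₜ^m ψ(T, x⋆) = 2 f^{(m+1)}(0) = 2 F ω^{m+1} χ^{(m+1)}(0)` (`centre_value_eq_two_deriv` below is
  the kernel-checked germ of this: the centre value of `(f(t+ρ) − f(t−ρ))/ρ` is `2 f′(t)` — one
  power of `ω` GAINED over the shell profile).
* Bookkeeping (shell radius `T ≈ r`, the distance of the shell from the AF origin): the DR
  weights ask `F ω² / r = o(r⁻³)` (from `h`, `m = 2`, and from `k`, `m = 1`), i.e.
  `F ω² = o(r⁻²)`, while the focal `C²` size is `F ω³ = o(r⁻²) · ω`, UNBOUNDED for `ω ≫ r²`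
  (`focusing_exponents`: `r = n + 1`, `ω = r⁴`, `F = r⁻¹¹` gives DR-size `F ω² r² = r⁻¹ → 0` and
  focal size `F ω³ = r → ∞`). General rule: `(n, n−1)` weighted derivatives of `(h, k)` at `i⁰`
  protect late-time `C^{n−1}` and NOT `C^n` (nor `C^{n−1,α}`, `α > 0`): DR `(2,1)` protects `C¹`,
  not the summit's `C²`; CK `(4,3)` protects `C³`, not `C^{3,α}`/`C⁴`. (This is the classical
  derivative count of Kirchhoff's formula in three space dimensions — data `(f, g) ∈ C^{k+1} × C^k`
  give `u ∈ C^k` and not better in general: Folland, *Introduction to PDE*, Ch. 5 §B, Thm. (5.15)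
  and the remark after (5.18), p. 139 of the held copy; the explicit radial packet above is the
  standard sharpness example, transported to infinity along the DR weights.)
* Gravity. Replace `ψ` by a linearised-gravity packet (time-reversed emission of a compactly
  supported pulse from the event `(Tₙ, x⋆ₙ)` on the packet-free development, propagated BACKWARD to
  the initial slice: an incoming, correctly pre-aberrated shell of radius `≈ Tₙ` plus tails),
  superpose packets `n = 1, 2, …` at radii `rₙ ↑ ∞` (causally separated up to their focal times)
  with `Fₙ ωₙ² rₙ² → 0` (so the sum converges in the DR norms and the data stay smooth, complete,
  one-ended), correct the constraints perturbatively (linearised constraints hold exactly; the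
  conformal-method correction is quadratic in the amplitudes), and note that each packet is weak
  in every scale-invariant norm (`F ω ≪ 1` at the focus), so Cauchy stability on the compact
  domain of dependence of packet `n` puts the focal event `qₙ` with
  `|Riem(qₙ)| ≳ Fₙ ωₙ³ → ∞` (a frame-independent lower bound: `E² − B² ≈ E² ≠ 0` at the focal
  instant) inside EVERY MGHD of the perturbed datum. [refuter-level; the two non-explicit steps are
  the perturbative constraint correction and per-packet Cauchy stability]
* Where to put the foci. (a) `x⋆ₙ = x⋆` fixed in the near/intermediate zone, `Tₙ → ∞`: the late
  near-zone geometry is NOT bounded in `C²` (let alone `C^{3,α}`): every "orbital boundedness" input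
  fails pointwise for such data. (b) RECEDING foci `|x⋆ₙ| = log Tₙ`: every FIXED near zone
  `{r ≤ R}` sees only finitely many foci, so near-zone tameness on fixed compacts and "all late
  holes are Kerr" survive, while the summit decomposition still fails (below). (c) Foci near `i⁰`
  (`|x⋆ₙ| ≈ 2Tₙ`) defeat only slab-to-`i⁰` formulations.

### Why `P(D₀)` fails for `D₀ = D + packets` (every admissible `D`; variant (a) or (b))

Let `d : FinalStateDecomposition 𝒟 O 2`, `O = exteriorOf 𝒟 d.charted`, `HasExhaustiveCharts d`
with radii `R`. The focal events `qₙ` lie in `O` (to the future of the slice; a timelike curve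
from `qₙ` reaches the charted late region). Fix `τ₁ > τ₀`. The `qₙ` accumulate at `i⁺` along a
future-complete timelike curve of bounded (variant (b): logarithmically growing) radius, so only
finitely many lie in `J⁻(certifiedSlab d R τ₁)` (the flat slab is a complete uniformly
spacelike hypersurface — `C⁰`-closeness to `η` in the chart — and the hole slabs are compact),
hence by exhaustiveness all later `qₙ` lie in `certifiedLate d R τ₁`: on a flat slab
`x⁰ = τ′ₙ > τ₁` or on a truncated hole slab `t*ᵢ = τ″ₙ > τ₁, rᵢ ≤ Rᵢ(τ″ₙ)`. As `τ₁` was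
arbitrary, `τ′ₙ → ∞` (resp. `τ″ₙ → ∞` for a fixed `i`). At the preimage of `qₙ` the chart frame is
`(1+ε)`-quasi-orthonormal (`C⁰` part of the deviation), so
`‖D²(Ψ^*g − g_bg)‖ ≥ c |Riem(qₙ)| − |Riem(g_bg)| − C ε → ∞`, i.e. the `C²` deviation on those slabs
is FREQUENTLY LARGE along `τ → ∞`, contradicting `Tendsto … (𝓝 0)`
(`not_tendsto_deviationCk_of_frequently_le`, `not_tendsto_truncDeviationCk_of_frequently_le`:
the kernel-checked last step). Completeness of `𝓘⁺` and MGHD existence are untouched.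

### Consequences

1. `FinalStatePointwise` (§4) is FALSE — `not_finalStatePointwise`, a NEAR-MISS carried with
   `sorry` (the witness needs MGHD/linearised-gravity constructions absent from the tree); one bad
   admissible datum suffices (`not_finalStatePointwise_of_bad`, checked). The hub note
   `Cruxes/HonestFixedRadiusSettling/NegativeNotes-far-field-dust-ideator3.md` (B1: "k = 2 is
   exactly protected: aω² = o(r⁻²) forces C² → 0") considered radial trains through a fixed
   radius (gain `r/R`) but not FOCI (gain `r·ω`); with foci, `k = 2` is NOT protected.
2. The summit survives only through the topology-free curve genericity: its exceptional set
   contains `{D + packets}` — dense in the DR topology (indeed residual) — and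
   `FinalStateConjecture` ⇔ [`P` on a far-regular subclass `𝓣`] + [ESCAPE: through every bad
   admissible datum an admissible smooth injective curve whose other members lie in `𝓣`]
   (`isChristodoulouGeneric_of_escape`, `isChristodoulouGeneric_iff_escape`,
   `summit_of_pointwiseOn_of_escape`; escape is plausible by truncating the far field beyond
   radius `1/|c|` and re-solving the constraints — joint smoothness in `(c, y)` is local, so
   nothing prevents it — but it is a gluing theorem at `i⁰`, owed by EVERY route of this summit).
   AUDIT-LEVEL REMARK for the operator: with `k = 2` the admissible class should control
   `(3, 2)` weighted derivatives (CK's `(4, 3)` does), or the conjunct should be `k = 1`, if the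
   registered informal statement's "generic" is to mean anything topological.
3. For THIS crux and its picked line (kerr-avoidance-dichotomy; stubs registered 02:08Z, skeleton
   not yet published in `Lines/`): any POINTWISE capture/settling stub over `admissibleVacuumData`
   — e.g. `stub_capture` "tame late frame + all cluster holes Kerr ⇒ ∃ C² decomposition with
   exhaustive charts" — is refuted by variant (b) UNLESS its tameness hypothesis controls the far
   field of the DATUM to `(3,2)` weighted derivatives (better: Kerr/Schwarzschild outside a compact
   set), or is itself a late-time `C²` bound on GROWING zones `r ≤ R(τ) → ∞` covering the foci.
   Near-zone `C³_loc`/`C^{3,α}` convergence (the card's `lim`) needs `(4,3)`/(`5,4`). The escape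
   stub (`stub_wildAvoidable`) is where the far-field gluing lives; it cannot be weakened to
   "DR-small modification" without re-solving constraints globally.
-/

/-- Focusing bookkeeping (`r = n+1`, `ω = r⁴`, `F = r⁻¹¹`): the DR-binding quantity `F ω² r²`
tends to `0` while the focal `C²` size `F ω³` tends to `+∞`. [folklore] -/
theorem focusing_exponents :
    ∃ F w : ℕ → ℝ, (∀ n, 0 < F n) ∧ (∀ n, 0 < w n) ∧
      Tendsto (fun n ↦ F n * w n ^ 2 * ((n : ℝ) + 1) ^ 2) atTop (𝓝 0) ∧
      Tendsto (fun n ↦ F n * w n ^ 3) atTop atTop := by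
  refine ⟨fun n ↦ (((n : ℝ) + 1) ^ 11)⁻¹, fun n ↦ ((n : ℝ) + 1) ^ 4, fun n ↦ by positivity,
    fun n ↦ by positivity, ?_, ?_⟩
  · have h : (fun n : ℕ ↦ (((n : ℝ) + 1) ^ 11)⁻¹ * (((n : ℝ) + 1) ^ 4) ^ 2 * ((n : ℝ) + 1) ^ 2)
        = fun n : ℕ ↦ ((n : ℝ) + 1)⁻¹ := by
      funext n
      have hn : (n : ℝ) + 1 ≠ 0 := by positivity
      field_simp
    rw [h]
    exact tendsto_inv_atTop_zero.comp
      (tendsto_atTop_add_const_right atTop (1 : ℝ) tendsto_natCast_atTop_atTop)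
  · have h : (fun n : ℕ ↦ (((n : ℝ) + 1) ^ 11)⁻¹ * (((n : ℝ) + 1) ^ 4) ^ 3)
        = fun n : ℕ ↦ (n : ℝ) + 1 := by
      funext n
      have hn : (n : ℝ) + 1 ≠ 0 := by positivity
      field_simp
    rw [h]
    exact tendsto_atTop_add_const_right atTop (1 : ℝ) tendsto_natCast_atTop_atTop

/-- The germ of focusing: for `f` differentiable at `t`, the centre value of the regular radial
solution `(f(t+ρ) − f(t−ρ))/ρ` of the `1+3` wave equation is `2 f′(t)` — one derivative (one power
of the frequency) gained over the shell profile. [folklore: d'Alembert/Kirchhoff] -/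
theorem centre_value_eq_two_deriv {f : ℝ → ℝ} {t f' : ℝ} (hf : HasDerivAt f f' t) :
    Tendsto (fun ρ ↦ (f (t + ρ) - f (t - ρ)) / ρ) (𝓝[≠] 0) (𝓝 (2 * f')) := by
  have ha : HasDerivAt (fun ρ ↦ f (t + ρ)) f' 0 :=
    HasDerivAt.comp_const_add t 0 (by simpa using hf)
  have hb : HasDerivAt (fun ρ ↦ f (t - ρ)) (-f') 0 :=
    HasDerivAt.comp_const_sub t 0 (by simpa using hf)
  have hg := (ha.sub hb).tendsto_slope_zero
  have e : f' - -f' = 2 * f' := by ring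
  rw [e] at hg
  refine hg.congr' ?_
  filter_upwards [self_mem_nhdsWithin] with ρ (hρ : ρ ≠ 0)
  simp only [Pi.sub_apply, zero_add, add_zero, sub_zero, sub_self, smul_eq_mul, div_eq_inv_mul]

/-- An `ℝ≥0∞`-valued function which is FREQUENTLY at least `c ≠ 0` along a filter does not tend
to `0` along it. [folklore] -/
theorem not_tendsto_zero_of_frequently_le {ι : Type*} {l : Filter ι} {u : ι → ℝ≥0∞} {c : ℝ≥0∞}
    (hc : c ≠ 0) (h : ∃ᶠ i in l, c ≤ u i) : ¬ Tendsto u l (𝓝 0) := by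
  intro ht
  have hev : ∀ᶠ i in l, u i < c := ht.eventually_lt_const (pos_iff_ne_zero.2 hc)
  obtain ⟨i, hi, hi'⟩ := (h.and_eventually hev).exists
  exact absurd hi (not_le.2 hi')

/-- THE LAST STEP OF THE FOCUSING ARGUMENT, flat chart (kernel-checked): if along `τ → ∞` there
are, frequently, points of the flat slab `{t = τ}` at which some derivative of order `m ≤ k` of
the extended deviation `Ψ^* g − g₀` has norm at least `c ≠ 0`, then the `Cᵏ` slab deviation does
not tend to `0` — the field `tendsto_deviationCk_flat` of a `FinalStateDecomposition` is
violated. [folklore] -/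
theorem not_tendsto_deviationCk_of_frequently_le {𝓢 : Spacetime 4} {B : ModelBackground}
    {Ψ : B.domain → 𝓢.carrier} {k m : ℕ} (hm : m ≤ k) {c : ℝ≥0∞} (hc : c ≠ 0)
    (h : ∃ᶠ τ in atTop, ∃ x ∈ B.timeSlab τ,
      c ≤ ‖iteratedFDeriv ℝ m (𝓢.deviationExtend B Ψ) (x : E4)‖ₑ) :
    ¬ Tendsto (fun τ ↦ 𝓢.deviationCk B Ψ k τ) atTop (𝓝 0) := by
  refine not_tendsto_zero_of_frequently_le hc (h.mono ?_)
  rintro τ ⟨x, hx, hcx⟩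
  exact hcx.trans (enorm_iteratedFDeriv_le_supCkENorm hm (Set.mem_image_of_mem Subtype.val hx) _)

/-- THE LAST STEP OF THE FOCUSING ARGUMENT, hole charts / growing near zones (kernel-checked):
frequent large derivatives at points of the truncated slabs `{t = τ, r ≤ R τ}` forbid
`truncDeviationCk … k (R τ) τ → 0` — clause (i) of `HasExhaustiveCharts` is violated. [folklore] -/
theorem not_tendsto_truncDeviationCk_of_frequently_le {𝓢 : Spacetime 4} {B : ModelBackground}
    {Ψ : B.domain → 𝓢.carrier} {k m : ℕ} (hm : m ≤ k) {R : ℝ → ℝ} {c : ℝ≥0∞} (hc : c ≠ 0)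
    (h : ∃ᶠ τ in atTop, ∃ x ∈ B.truncTimeSlab (R τ) τ,
      c ≤ ‖iteratedFDeriv ℝ m (𝓢.deviationExtend B Ψ) (x : E4)‖ₑ) :
    ¬ Tendsto (fun τ ↦ 𝓢.truncDeviationCk B Ψ k (R τ) τ) atTop (𝓝 0) := by
  refine not_tendsto_zero_of_frequently_le hc (h.mono ?_)
  rintro τ ⟨x, hx, hcx⟩
  exact hcx.trans (enorm_iteratedFDeriv_le_supCkENorm hm (Set.mem_image_of_mem Subtype.val hx) _)

/-- One bad admissible datum refutes the pointwise final-state statement (the shape in which the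
focusing witness enters). [folklore] -/
theorem not_finalStatePointwise_of_bad {X : Type} [TopologicalSpace X] [ChartedSpace E3 X]
    [IsManifold (𝓡 3) ∞ X] [T2Space X] [SecondCountableTopology X] [ConnectedSpace X]
    {D : InitialDataSet (𝓡 3) X} (hD : D ∈ admissibleVacuumData X) (h : ¬ SummitProperty X D) :
    ¬ FinalStatePointwise :=
  fun hP ↦ h (hP X D hD)

/-- **NEAR-MISS (paper refutation; `sorry` permitted in this work file only).** The pointwise
final-state statement is FALSE: for every admissible datum `D` (on any slice carrying one, e.g.
`trivialData` on `Minkowski.slice`), either `D` itself or `D +` a DR-small train of far-field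
FOCUSING packets (module docstring §7, variant (a) or (b)) is an admissible datum whose every MGHD
carries focal events `qₙ → i⁺` with `|Riem(qₙ)| → ∞`, which no `C²` final-state decomposition with
exhaustive charts tolerates (`not_tendsto_deviationCk_of_frequently_le`,
`not_tendsto_truncDeviationCk_of_frequently_le`). OBSTRUCTION TO CLOSING IT HERE: the tree
constructs no MGHD of any non-trivial datum, has no linearised-gravity packets and no
perturbative constraint solver; the two non-explicit analytic inputs are (i) perturbative
correction of the constraints for DR-small far-field perturbations, (ii) Cauchy stability on the
compact domain of dependence of each packet. WHAT WAS TRIED: reduction to a uniform junk failure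
(§3) — none exists; the scalar model (exact) and the exponent bookkeeping (`focusing_exponents`).
[refuter-level] -/
theorem not_finalStatePointwise : ¬ FinalStatePointwise := by
  sorry

/-- Curve-genericity from ESCAPE (abstract form): if `P` holds on a subclass `𝓣` of the admissible
class `𝓓` and every bad admissible datum lies on a smooth injective admissible curve all of whose
other members are in `𝓣`, then `P` is Christodoulou-generic in `𝓓` with codimension `1`. This is
the only way the summit can absorb its DR-dense pointwise exceptional set (§7). [folklore] -/
theorem isChristodoulouGeneric_of_escape {E' H' : Type*} [NormedAddCommGroup E'] [NormedSpace ℝ E']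
    [TopologicalSpace H'] {I' : ModelWithCorners ℝ E' H'} {Y : Type*} [TopologicalSpace Y]
    [ChartedSpace H' Y] [IsManifold I' ∞ Y] {𝓓 𝓣 : Set (InitialDataSet I' Y)}
    {P : InitialDataSet I' Y → Prop} (hP : ∀ d ∈ 𝓣, d ∈ 𝓓 → P d)
    (hesc : ∀ d ∈ 𝓓, ¬ P d → ∃ F : EuclideanSpace ℝ (Fin 1) → InitialDataSet I' Y,
      InitialDataSet.IsSmoothDataFamily 1 F ∧ F 0 = d ∧ Function.Injective F ∧
        (∀ c, F c ∈ 𝓓) ∧ ∀ c ≠ 0, F c ∈ 𝓣) :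
    InitialDataSet.IsChristodoulouGeneric 𝓓 P 1 := by
  rintro d ⟨hd, hbad⟩
  obtain ⟨F, hF, h0, hinj, h𝓓, h𝓣⟩ := hesc d hd hbad
  exact ⟨F, hF, h0, hinj, h𝓓, fun c hc hmem ↦ hmem.2 (hP _ (h𝓣 c hc) hmem.1)⟩

/-- … and conversely genericity IS escape to the good set: `IsChristodoulouGeneric 𝓓 P 1` iff
every bad admissible datum lies on a smooth injective admissible curve all of whose other members
satisfy `P`. [folklore] -/
theorem isChristodoulouGeneric_iff_escape {E' H' : Type*} [NormedAddCommGroup E']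
    [NormedSpace ℝ E'] [TopologicalSpace H'] {I' : ModelWithCorners ℝ E' H'} {Y : Type*}
    [TopologicalSpace Y] [ChartedSpace H' Y] [IsManifold I' ∞ Y] {𝓓 : Set (InitialDataSet I' Y)}
    {P : InitialDataSet I' Y → Prop} :
    InitialDataSet.IsChristodoulouGeneric 𝓓 P 1 ↔
      ∀ d ∈ 𝓓, ¬ P d → ∃ F : EuclideanSpace ℝ (Fin 1) → InitialDataSet I' Y,
        InitialDataSet.IsSmoothDataFamily 1 F ∧ F 0 = d ∧ Function.Injective F ∧
          (∀ c, F c ∈ 𝓓) ∧ ∀ c ≠ 0, P (F c) := by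
  constructor
  · intro h d hd hbad
    obtain ⟨F, hF, h0, hinj, h𝓓, hgood⟩ := h d ⟨hd, hbad⟩
    exact ⟨F, hF, h0, hinj, h𝓓, fun c hc ↦ by
      by_contra hc'
      exact hgood c hc ⟨h𝓓 c, hc'⟩⟩
  · intro h
    exact isChristodoulouGeneric_of_escape (𝓣 := {d | P d}) (fun d hd _ ↦ hd) h

/-- The REPAIRED SHAPE of every settling route after §7: the summit follows from (i) the summit
property on a far-regular subclass `𝓣 X ⊆` admissible data of each slice and (ii) ESCAPE of every
bad admissible datum into `𝓣 X` along an admissible smooth injective curve (a gluing theorem at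
spatial infinity). Pure logic over `summit_iff`. [folklore] -/
theorem summit_of_pointwiseOn_of_escape
    (𝓣 : ∀ (X : Type) [TopologicalSpace X] [ChartedSpace E3 X] [IsManifold (𝓡 3) ∞ X],
      Set (InitialDataSet (𝓡 3) X))
    (hP : ∀ (X : Type) [TopologicalSpace X] [ChartedSpace E3 X] [IsManifold (𝓡 3) ∞ X]
      [T2Space X] [SecondCountableTopology X] [ConnectedSpace X],
      ∀ D ∈ 𝓣 X, D ∈ admissibleVacuumData X → SummitProperty X D)
    (hesc : ∀ (X : Type) [TopologicalSpace X] [ChartedSpace E3 X] [IsManifold (𝓡 3) ∞ X]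
      [T2Space X] [SecondCountableTopology X] [ConnectedSpace X],
      ∀ D ∈ admissibleVacuumData X, ¬ SummitProperty X D →
        ∃ F : EuclideanSpace ℝ (Fin 1) → InitialDataSet (𝓡 3) X,
          InitialDataSet.IsSmoothDataFamily 1 F ∧ F 0 = D ∧ Function.Injective F ∧
            (∀ c, F c ∈ admissibleVacuumData X) ∧ ∀ c ≠ 0, F c ∈ 𝓣 X) :
    _root_.FinalStateConjecture :=
  summit_iff.2 fun X _ _ _ _ _ _ ↦ isChristodoulouGeneric_of_escape (hP X) (hesc X)

/-! ## §8 Targets (cycle 2): the registered skeleton `Lines/kerr-avoidance-dichotomy.lean` (5 stubs,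
2026-08-16T02:08:55Z; module not importable from here, so its declarations are quoted, not used)

### T1. STUB-MISSTATED — `LateFrame.IsTame.telescope` (currency of S1, S3, S4, S5): the RE-HOSTING defect
`mem_cluster_iff` (by `Iff.rfl`) makes membership of `p : ChartedHole` in `F.cluster i` depend on `p` only
through the PROFILE triple `(p.adapted.domain, p.adapted.radius, p.adapted.bilin)` (`IsCompatible` reads
domain and radius, `ConvergesAlong` reads `(F.hole i).bg p.adapted.bilin`), while `IsTame.telescope : ∀ p ∈
F.cluster i, IsTelescopeHole p.hole ∧ …` constrains the HOST `p.hole` (global hyperbolicity and `Ric = 0` of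
its WHOLE carrier), and `AdaptedChart` pins the host only on the chart image. JUNK TWIN (paper; the expected,
GOOD case of a Kerr collar profile on `U = ℝ × {r > r₁}`): host the same profile on the ingoing Kerr patch
`{r > r₁'}`, `r₋ < r₁' < r₁`, with a closed `T`-invariant tube `ℝ × K`, `K ⊂ {r₁' < r < r₁}` a small ball,
deleted (slice `{t* = 0} ∖ K`, same end, Kerr data restricted, `∂_{t*}` complete): vacuum, stationary AF,
connected non-degenerate horizon, unchanged d.o.c. — but NOT globally hyperbolic (a diamond through the
deleted tube is not compact), so not a telescope hole; the inclusion of `{r > r₁}` is a valid adapted chart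
with the SAME triple. Hence the twin is in the cluster and `telescope` fails: no frame with `N ≥ 1` and Kerr
(or stationarily extendible, or roomily hosted) cluster profiles is tame; `Tame X D` then forces `N = 0`
(dispersal in `C³`; a black-hole development has no tame `N = 0` frame: the flat slabs are images of all of
`ℝ³`, lie in `O ⊆` closure of the d.o.c. and must become `C³`-flat); `KerrAvoiding`, `BombLimited` are
false; S3, S5 vacuous, S4 reduces to `N = 0`, and S1 (`stub_wildAvoidable`) reads "every non-dispersing
admissible datum lies on an admissible curve ALL of whose other members disperse" — FALSE for a datum with
a trapped surface in a compact region (joint smoothness ⇒ `C¹_loc` convergence ⇒ trapped surfaces persist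
for small `c`; Penrose). Abstract kernel-checked form: `forall_host_fails_of_bad_twin`. REPAIR: (R1) add
`Set.range p.adapted.toFun = Set.univ` to `ChartedHole`/`IsCompatible` (canonical host = `(U, profile)`), or
(R2) `telescope : ∀ p ∈ F.cluster i, ∃ q, (same triple) ∧ IsTelescopeHole q.hole ∧ q.hole.horizon ⊆ range
q.adapted.toFun` and read `KerrAvoiding`/`BombLimited`/S4's hypothesis through the same existential.
Filed: `Negative-notes/IsTame-telescope.md` + evidence note `stub-misstated: IsTame.telescope …`.

### T2. `stub_capture` (S4) vs far-field focusing (§7): SURVIVES — `IsTame.exhaustive` (i) is a late-time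
`C³` bound on the GROWING zones `r ≤ R i τ` and `LateFrame.tendsto_deviationCk_flat` a full-slab `C³` bound,
so far-focusing data are non-tame and are owed by S1, whose internal cut list (a)–(f) lacks the far-field
regularisation (gluing at `i⁰`) that must come first; `LateFrame`'s `C³` flat clause makes `Tame` require
`(4,3)`+ far-field regularity of the datum (the DR class gives `(2,1)`).

### T3. `stub_kerrIsolation` (S2): no cheap kill (no non-Kerr telescope hole is known); typed remark only —
the `C³` smallness is demanded on ONE slab `{t* = 0, r ≤ R}` of the collar background with no far-field
control, so the stub contains the a-priori exterior statement "stationary vacuum AF end `ε`-close to Kerr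
on a sphere is close outside" (the skeleton's own cut (ii)); and `IsTelescopeHole 𝓑` has the same host-level
sensitivity as T1 (here harmless: it is a hypothesis).

### T4. `stub_dichotomy` (S3): under repair R1/R2 its clopen argument needs the cluster set CONNECTED in the
`C³_loc` uniformity; as typed `F.cluster i` is a bare subset of `ChartedHole` (no topology), so connectedness
must be proved inside the stub from `IsTame.subseq` + continuity of `τ ↦ g_τ` — the Hale argument needs the
curve continuous and precompact in a METRISABLE uniformity on profiles restricted to slabs; recorded for the
lead, not a kill.
-/

/-- T1, abstract kernel-checked form of the re-hosting defect: if membership `mem` in a set of charted holes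
factors through a profile map `prof` (as `F.cluster i` does, by `mem_cluster_iff`), then a universal
host-level clause `∀ q, mem q → good q` is refuted by ONE member whose profile admits a bad host. [folklore] -/
theorem forall_host_fails_of_bad_twin {H P : Type*} (prof : H → P) (mem good : H → Prop)
    (hmem : ∀ q q', prof q' = prof q → mem q → mem q') {q q' : H} (hq : mem q)
    (htwin : prof q' = prof q) (hbad : ¬ good q') : ¬ ∀ r, mem r → good r :=
  fun h ↦ hbad (h q' (hmem q q' htwin hq))

/-! ## §9 Targets (cycle 3, 2026-08-16T03Z): the PICKED line `one-locked-explosion`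
(`Lines/one-locked-explosion.lean`, 7 stubs, skeleton checked 02:36Z; PICKED.md prefers it over
`symplectic-dual-of-the-bomb` and `kerr-avoidance-dichotomy`). The module has no `.olean` (not importable from a
work file), so the two predicates attacked are QUOTED VERBATIM in `namespace Quote` and the kernel lemmas are about
the quotes; `Stub1LocalEscapeSuffices.lean` (evidence file, rc 0, axioms {propext, choice, Quot.sound}) PROVES stub 1
against a verbatim quote.

### T5. STUB-PROVED (candidate, positive — a prover lands it): `stub_localEscapeSuffices` (stub 1).
Proof = the docstring's reparametrisation with `θ_ε(c) = (ε/2)(1+‖c‖²)^{-1/2} c` (smooth, injective, `θ 0 = 0`,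
`‖θ c‖ < ε`, `θ c ≠ 0` for `c ≠ 0`); `IsSmoothDataFamily` is stable under `θ × id` by `ContMDiff.comp/prodMap`.
File `Stub1LocalEscapeSuffices.lean` in the seat folder, attached as item evidence (`Disproof.Stub1.localEscapeSuffices`).

### T6. STUB-MISSTATED — `IsExplosionExit` (the typed interface stub 6 → stub 7; also stub 6's conclusion format)
READING (quote below). `IsExplosionExit 𝓑 ν Y e` := `e` admissible ∧ ∃ MGHD `𝒟` of `e` ∧ ∃ adapted chart `A` of `𝓑`, ∃
`Ψ : A.domain → 𝒟` smooth injective with (o) `A` asymptotically Cartesian, (i) early truncated leaves `Ψ{t=τ, r≤R}` in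
`I⁻(ι Y)`, (ii) `∃ C, ∀ τ ≤ 0, deviationCk A.background Ψ 2 τ ≤ C e^{ντ}` (FULL leaves), (iii) `∃ τ, deviationCk … τ ≠ 0`.

DEFECT (a): (iii) is unrestricted in `τ` while (ii) binds only `τ ≤ 0`: an identification `Ψ` that is EXACTLY `𝓑` on every
early leaf and differs from `A.bilin` on ONE late leaf satisfies (ii) ∧ (iii) — at EVERY rate `ν` at once
(`Quote.isExplosionExit_of_exact_early`, kernel-checked; an honest explosion has one rate).
DEFECT (b): (ii)/(iii) are measured in the prover-CHOSEN identification `Ψ` (a gauge). Non-vanishing in SOME gauge is free: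
precompose an exact `Ψ` with `W(t,y) = (w(t),y)`, `w` a diffeomorphism of `ℝ`, `w = id` off `(2,3)`, `w′ ≢ 1` there; then
`Ψ′^*g(∂₀,∂₀) = w′(t)² g(T,T) ≠ A.bilin(∂₀,∂₀)` wherever `g(T,T) ≠ 0`, so (iii) holds at `τ = 2.5`, while (i)/(ii) are untouched
(all derivatives of `Ψ′` agree with those of `Ψ` on `{t < 2}`); with the wiggle on `(−3,−2)` and `C ≥ e^{3|ν|}·(its C²-size)` even
"(iii) at some τ ≤ 0" holds. The predicate cannot tell "a nontrivial ancient solution leaving `𝓑` along the top mode" from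
"`𝒟` contains an exact copy of the early wedge `⋃_{τ≤0} φ_A{t=τ}` of `𝓑`".
WITNESS OF THE SECOND KIND, GOOD, NO EXPLOSION (paper; `𝓑` = Schwarzschild `M>0`; verbatim for sub-extremal Kerr with the
Boyer–Lindquist–Kruskal extension across `r₊`, whose region III is a second Kerr exterior). Kruskal `U = −e^{−κu}`, `V = e^{κv}`
(`κ = 1/4M`) on region I, `𝓗⁺ = {U=0}`, left branch `𝓗_L = {V=0, U>0}`, time function `T = U+V`; normalise the chart time of
the ingoing Kerr–Schild chart `A` (a shift of `x⁰`, allowed: `A`'s domain is time-invariant) so that the leaf `t* = 0` meets `𝓗⁺`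
at `V = V₀ < 1`. (1) `Y_c := {U+V = c}`, `V₀ < c < 2`: a complete two-ended Cauchy hypersurface of Kruskal, above the bifurcation
sphere, crossing `𝓗⁺` at `V = c`, running through region II (`UV ≤ c²/4 < 1`), leaving it across `𝓗_L` at `U = c` into region III;
its data approach the `t=0` data like `O(e^{−r/4M})` at both ends (`t = 2M ln(1 + c e^{u/4M})` on `Y_c ∩ I`): DR rates with room.
(2) Cut the LEFT end at the large sphere `s := U−V = a ≫ 1` (region III, `r ≫ M`) and replace `{s ≥ a}` by a compact vacuum cap
`K ≅ B³` matching the data of `Y_c` near `{s=a}` — the ONE non-explicit step (a vacuum fill-in, from the far side, of exact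
Schwarzschild-slice annular data; expected from the flexibility of the under-determined constraints — Isenberg–Mazzeo–Pollack
CMP 231 (2002), Chruściel–Isenberg–Pollack CMP 257 (2005), Corvino–Schoen JDG 73 (2006) gr-qc/0301071 — with the 4 Schwarzschild
KIDs on the annulus compensated by cap parameters; NOT a citation-level fact). `Y := (Y_c ∩ {s<a}) ∪ K ≅ ℝ³`: complete, one AF end
with compact complement (`IsSoleEnd`), vacuum, DR-flat ⇒ `e := (Y,h,k)` ADMISSIBLE. (3) Causality: `K ⊂ {U>0} ∩ {V<0}` while
`U` (resp. `V`) is non-decreasing along future (resp. past-to-future) causal curves, so `J⁺(K) ⊂ {U>0}`, `J⁻(K) ⊂ {V<0}`, both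
disjoint from region I; every inextendible causal curve through a region-I point meets `Y_c` inside `P′ := Y_c ∩ {s < a−2}` (from
below at `U = c − V < c`, from above in the past at `U < 0`), hence region I `⊆ D(P′)°` = the MGHD of the data on `P′` ⊆ the MGHD
`𝒟` of `e` (locality of maximal developments). So `𝒟 ⊇` the WHOLE Schwarzschild exterior, all leaves `L_τ = {t* = τ}` included, and
on `L_τ ∩ {r ≤ R}` one has `U+V ≤ V ≤ e^{κ(τ+R)}·V₀e^{−κ r₊} → 0 < c` for `τ → −∞`: early truncated leaves lie below the Cauchy surface,
in `I⁻(ι Y)` — clause (i). (4) `Ψ :=` the chart map `A.domain → I ⊂ 𝒟` followed by the late wiggle `W`: smooth, injective,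
`deviationCk = 0` on every leaf `τ < 2` (clause (ii) for EVERY `ν`, `C = 0`) and `≠ 0` at `τ = 2.5` (clause (iii)); `A` is an
`AdaptedChart` of the Schwarzschild hole (domain `ℝ × {‖y‖ > 2M}` time-invariant, `dφ ∂₀ = ∂_{t*}`, covers the d.o.c., range `⊆ I⁺(M_ext)`,
radius `‖y‖`; `g_KS → η`, leaves spacelike: clause (o)). Hence `IsExplosionExit 𝓑_Schw ν Y e` for all `ν ∈ ℝ`. (5) `e` is GOOD: the
exterior future of `ι Y` is the exact Schwarzschild exterior above `Y_c ∩ I`: complete `𝓘⁺` (sojourn form), `N = 1`, `a = 0 < M`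
Kerr–Schild decomposition with exhaustive charts (the summit audit's expected geometry), for the constructed MGHD hence for all.
So `IsExplosionExit 𝓑 ν Y e ∧ SummitProperty Y e` holds with NO explosion. FILL-IN-FREE VARIANT (found independently and first by the
drefuter, `NegativeNotes-drefute-one-locked-explosion.md` (E1), 03:24Z — cited, not mine): the `ℝP³` GEON `Kruskal/ℤ₂`
(`(T,X,ω) ↦ (T,−X,−ω)`; vacuum, time-orientable, globally hyperbolic, ONE AF end), `Y = {T = T₁}/ℤ₂ ≅ ℝP³ ∖ pt`, `0 < T₁ < 1`
(`admissibleVacuumData` has no `Y ≅ ℝ³` clause): same clauses (i)–(iii), no cap needed.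

DEFECT (c) (deeper; paper, generic): the INTENDED witnesses cannot satisfy (i) ∧ (ii) at all. (ii) on FULL early leaves of a
d.o.c.-covering `T`-adapted chart forces `𝒟 ⊇` a near-isometric copy of the early wedge, whose near-horizon tips accumulate on the
early segment of `𝓗⁺` down to the bifurcation corner; by (i) and the Cauchy property of `ι Y`, every ingoing null ray from that
segment (Kruskal `{V = const → 0}`, climbing the inside of the hole along `𝓗_L`) must be cut by `ι Y`; `Y ∖ far` compact ⇒ these cuts
accumulate at a point `y_* ∈ ι Y` with `V = 0`, `U = U_* < ∞` (the alternative `U → ∞` is a cylindrical end of infinite proper length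
`∫ √(F f₁) dU/U`, excluded by `IsSoleEnd`): `ι Y` CROSSES THE LEFT HORIZON BRANCH `𝓗_L`, as `Y_c` does. For exact `𝓑` this is harmless;
for a genuine explosion it is fatal: a `T`-eigen-perturbation of rate `s = ν + iω`, `ν > 0`, smooth across `𝓗⁺` has, near the bifurcate
structure (Kruskal-type coordinates exist by non-degeneracy, Rácz–Wald CQG 9 (1992) 2643), the form `V^{s/κ} G(UV, ω)` (the other
branch `U^{−s/κ}` blows up on `𝓗⁺`), which is `C^{⌈ν/κ⌉−1}` and NOT `C^∞` across `{V = 0}` unless `ω = 0 ∧ ν/κ ∈ ℕ`; the transversal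
singularity is transported from `𝓗⁺` along the rays `{V = const}` to every finite `U` by the vacuum equations integrated in `U`
(`∂_U ∂_V^k h = lower order`; nonlinear version: propagation of weak null singularities along characteristic hypersurfaces,
Luk–Rodnianski), so the MGHD of a SMOOTH datum cannot contain `y_*`. Equivalently: the early NEAR ZONE of an explosion is never in the
past development of a one-ended exit slice — `D⁻` of the exterior part of an exit slice recedes outward at light speed
(`D⁻({t*=0, r>r₁}) ∩ L_τ ⊆ {r ≥ r₁ + |τ|}`), and re-creating the near zone from the cap's past development means choosing a slice of an
extension of the explosion through `𝓗_L`. (The alternative `U → ∞` along the cuts either makes `ι Y ∖ far` non-compact or piles infinitely many pairwise disjoint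
Killing-translates of one collar cell — equal positive 4-volumes — into a compact causal diamond of `𝒟` around the limit cut:
excluded.) SCOPE: written for horizon-penetrating (ingoing, `t*`-type) leaves — the skeleton's "expected choice" — whose early wedge borders the early segment of `𝓗⁺`; for Boyer–Lindquist-type charts (all leaves ending at the bifurcation sphere) the early wedge is the past of one BL slice, the cuts/accumulation move to the bifurcation corner itself (either `𝒟` contains the early `𝓗⁺` segment and the argument above runs, or `ι Y` dips to the corner, where `V^{s/κ}G` is non-smooth from the region-I side), same conclusion, same genericity caveats. Loopholes: quantised real rates `ω₁ = 0 ∧ ν₁/κ ∈ ℕ`; perturbations vanishing to infinite order at `𝓗⁺` at early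
times without vanishing (a failure of unique continuation for `T`-modes inside the ergoregion — nobody proposes these).

CONSEQUENCES AS TYPED (revised with the drefuter's (E1)(a), which I confirm: `deviationCk … 2 τ = 0` on ONE full leaf means equal
Cauchy data `(h,k)` on `Ψ(L_τ)`, whose future domain of dependence in `𝓑` is the whole later d.o.c. — `t*` is a time function on the
d.o.c. tending to `−∞` along past-inextendible causal curves — so `𝒟`'s exterior future is EXACTLY `𝓑`'s for ever, and `SummitProperty Y e`
then forces `𝓑` to be Kerr). For the holes stubs 6–7 quantify over — NON-Kerr, `InTelescope`, simple top rate `ν₁` —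
  (J) exact-early-wedge witnesses (defects (a)/(b)) are excluded by `SummitProperty Y e`;
  (G) genuine top-mode explosion exits are excluded by defect (c) (generic `ν₁`);
hence `∃ Y e, IsExplosionExit 𝓑 ν₁ Y e ∧ SummitProperty Y e` is generically FALSE for every such hole: stub 6 as typed does not
resolve the bomb branch, it DENIES it (it is generically equivalent to "no non-Kerr telescope hole with a horizon-covering
asymptotically Cartesian chart and a simple top rate exists" — smooth rigidity in disguise, which the route refuses to assume), and
stub 7 is then vacuously true. The kernel composition `StationaryLimitReduction_of` still type-checks, but the line's XL content
has silently become "there are no bombs". For KERR holes (outside the stubs' range) the predicate is junk-satisfiable at every rate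
(capped `Y_c`, geon). Either way `IsExplosionExit` never means "top-mode explosion with exit datum `e`".
REPAIRS. (R1, minimal, fixes (a)/(b) only; `Quote.IsExplosionExitRepaired`, `Quote.isExplosionExit_of_repaired` : repaired → original)
replace (iii) by the gauge-invariant (iii*) `¬ ∃ Ψ′, ContMDiff … Ψ′ ∧ Injective Ψ′ ∧ (i)[Ψ′] ∧ ∀ τ ≤ 0, deviationCk A.background Ψ′ 2 τ = 0`
("no identification presents the early region as exactly `𝓑`") — it only makes (J) explicit; by (c) the predicate stays
unsatisfiable by the intended objects. (R2, structural, what the card means; fixes (a), (b), (c), (J) at once) SEPARATE the explosion from the exit datum: an auxiliary globally hyperbolic VACUUM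
spacetime `𝓔` (no admissibility, no one-endedness: its Cauchy surfaces have a cylindrical interior end, like the Kerr-star region)
carrying `A`, `Ψ : A.domain → 𝓔` with (ii) on full early leaves and (iii*) IN `𝓔`, plus an admissible `e` on `Y` whose data COINCIDE
(via a diffeomorphism) with the data `𝓔` induces on `Ψ{t = 0}` outside a compact `K ⊂ Y` that lies inside a trapped sphere of the
exit leaf (so `J⁺(K)` stays in the black-hole region and `SummitProperty Y e` tests exactly the exterior future of the explosion).
Stub 7 then shadows `𝓔` (its data live where the kicked developments live) and uses `SummitProperty Y e` only through Cauchy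
stability from the exit leaf onwards. Also hand stub 7 the explosion in the SAME chart as `sd.adapted i` (or the transition
isometry), since `IsExplosionExit`'s `A` is existential and may be collar-free while `SettlesTo` reads `sd.adapted i`.
Filed: `Negative-notes/IsExplosionExit.md` + evidence note `stub-misstated: IsExplosionExit …` on the crux item.

### T7. Remaining stubs (2–5), typed remarks only (no kernel verdict possible: no telescope hole / MGHD is constructible):
* stub 4 `SpinRaisingBridge` / stub 5 `TopModeGap`: `HasGrowingTensorMode`'s non-triviality `¬ IsPureGaugeOnDoc h₁` IS gauge-invariant
  (good); `IsSimpleTopRate` with `ϖ₁ = 0` lets `h₂` be an independent real top mode (real top eigenspace of dimension ≤ 2 mod gauge,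
  not 1) — harmless for the circle picture. `(0,0)` is a mode pair at every rate (`lieDerivBilin`/`linearizedRicci` vanish on `0`),
  correctly excluded by `¬ IsPureGaugeOnDoc` (`𝓛_0 g = 0`).
* stub 2 `SettleOrEscape` (c) demands `InTelescope` of every limit hole, i.e. the GLOBAL Hawking Killing field of h3 (§6 note 3) and
  global hyperbolicity of the host — the host-level sensitivity of cycle 2's T1 does not bite here (no cluster set; `sd.hole i` is the
  prover's own host), but the rigidity-of-the-limit debt stands.
* stub 3 `KerrLimitsAreGood`: its escape curve (iii) `c ↦` Kerr end glued outside `ρ(c) = e^{2/c²}` is jointly smooth at `c = 0` because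
  it is locally eventually constant in `c` at each point of `X` — fine; the `C¹ → C²` upgrade (ii) is where §7's focusing bites if the
  cleaning is skipped.
-/

namespace Quote

/-- VERBATIM `OneLockedExplosion.ChartIsAsymptoticallyCartesian` (Lines/one-locked-explosion.lean §0, 02:36Z). -/
def ChartIsAsymptoticallyCartesian {𝓑 : StationaryAFBlackHole.{0}} (A : 𝓑.AdaptedChart) : Prop :=
  (∀ ε : ℝ, 0 < ε → ∃ R₀ : ℝ, ∀ x : A.domain, R₀ ≤ A.radius x.1 → ‖A.bilin x.1 - Minkowski.bilin‖ ≤ ε) ∧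
    ∀ x : A.domain, ∀ v : E4, v 0 = 0 → v ≠ 0 → 0 < A.bilin x.1 v v

/-- VERBATIM `OneLockedExplosion.IsExplosionExit` (Lines/one-locked-explosion.lean §0, 02:36Z). -/
def IsExplosionExit (𝓑 : StationaryAFBlackHole.{0}) (ν : ℝ) (Y : Type) [TopologicalSpace Y] [ChartedSpace E3 Y]
    [IsManifold (𝓡 3) ∞ Y] [T2Space Y] [SecondCountableTopology Y] [ConnectedSpace Y]
    (e : InitialDataSet (𝓡 3) Y) : Prop :=
  e ∈ admissibleVacuumData Y ∧
    ∃ 𝒟 : VacuumCauchyDevelopment e, 𝒟.IsMaximal ∧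
      ∃ (A : 𝓑.AdaptedChart) (Ψ : A.background.domain → 𝒟.carrier),
        ChartIsAsymptoticallyCartesian A ∧
        ContMDiff 𝓘(ℝ, E4) (𝓡 4) ∞ Ψ ∧ Function.Injective Ψ ∧
          (∀ R : ℝ, ∀ᶠ τ in atBot,
            Ψ '' A.background.truncTimeSlab R τ ⊆
              𝒟.metric.chronologicalPast 𝒟.timeOrientation (Set.range 𝒟.embed)) ∧
          (∃ C : ℝ, ∀ τ : ℝ, τ ≤ 0 →
            𝒟.toSpacetime.deviationCk A.background Ψ 2 τ ≤
              ENNReal.ofReal (C * Real.exp (ν * τ))) ∧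
          ∃ τ : ℝ, 𝒟.toSpacetime.deviationCk A.background Ψ 2 τ ≠ 0

variable {𝓑 : StationaryAFBlackHole.{0}} {Y : Type} [TopologicalSpace Y] [ChartedSpace E3 Y]
    [IsManifold (𝓡 3) ∞ Y] [T2Space Y] [SecondCountableTopology Y] [ConnectedSpace Y]
    {e : InitialDataSet (𝓡 3) Y}

/-- **T6 (a), kernel-checked: exact early leaves are "explosion exits" at EVERY rate.** If an identification `Ψ`
of an adapted chart of `𝓑` into an MGHD of the admissible datum `e` satisfies the chart/past clauses, has
IDENTICALLY ZERO deviation on every early leaf `τ ≤ 0` (the development is exactly `𝓑` there) and a non-zero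
deviation on some (e.g. late, or gauge-wiggled) leaf, then `IsExplosionExit 𝓑 ν Y e` holds for all `ν ∈ ℝ`
simultaneously — the rate clause carries no information and the predicate does not express "explosion". [folklore] -/
theorem isExplosionExit_of_exact_early (he : e ∈ admissibleVacuumData Y) (𝒟 : VacuumCauchyDevelopment e)
    (hmax : 𝒟.IsMaximal) (A : 𝓑.AdaptedChart) (Ψ : A.background.domain → 𝒟.carrier)
    (hA : ChartIsAsymptoticallyCartesian A) (hΨ : ContMDiff 𝓘(ℝ, E4) (𝓡 4) ∞ Ψ)
    (hinj : Function.Injective Ψ)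
    (hpast : ∀ R : ℝ, ∀ᶠ τ in atBot, Ψ '' A.background.truncTimeSlab R τ ⊆
      𝒟.metric.chronologicalPast 𝒟.timeOrientation (Set.range 𝒟.embed))
    (hexact : ∀ τ : ℝ, τ ≤ 0 → 𝒟.toSpacetime.deviationCk A.background Ψ 2 τ = 0)
    (hne : ∃ τ : ℝ, 𝒟.toSpacetime.deviationCk A.background Ψ 2 τ ≠ 0) (ν : ℝ) :
    IsExplosionExit 𝓑 ν Y e :=
  ⟨he, 𝒟, hmax, A, Ψ, hA, hΨ, hinj, hpast, ⟨0, fun τ hτ ↦ by rw [hexact τ hτ]; exact bot_le⟩, hne⟩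

/-- Sanity (benign direction): an exit at rate `ν` is an exit at every slower rate `ν′ ≤ ν` (the rate clause is a
one-sided bound on `τ ≤ 0`, where `e^{ντ} ≤ e^{ν′τ}`). [folklore] -/
theorem IsExplosionExit.anti {ν ν' : ℝ} (h : IsExplosionExit 𝓑 ν Y e) (hν : ν' ≤ ν) :
    IsExplosionExit 𝓑 ν' Y e := by
  obtain ⟨he, 𝒟, hmax, A, Ψ, hA, hΨ, hinj, hpast, ⟨C, hC⟩, hne⟩ := h
  refine ⟨he, 𝒟, hmax, A, Ψ, hA, hΨ, hinj, hpast, ⟨max C 0, fun τ hτ ↦ (hC τ hτ).trans ?_⟩, hne⟩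
  refine ENNReal.ofReal_le_ofReal ?_
  have hexp : Real.exp (ν * τ) ≤ Real.exp (ν' * τ) := Real.exp_le_exp.2 (by nlinarith)
  calc C * Real.exp (ν * τ) ≤ max C 0 * Real.exp (ν * τ) :=
        mul_le_mul_of_nonneg_right (le_max_left _ _) (Real.exp_pos _).le
    _ ≤ max C 0 * Real.exp (ν' * τ) := mul_le_mul_of_nonneg_left hexp (le_max_right _ _)

/-- **The minimally REPAIRED predicate (proposal R1 of T6)**: `IsExplosionExit` with its gauge-dependent non-triviality
clause (iii) replaced by the gauge-INVARIANT (iii*) "no smooth injective identification of the chart domain satisfying the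
past clause presents the early region `τ ≤ 0` as exactly `𝓑`". Everything else verbatim. It removes defects (a)/(b) (the
exact-wedge junk), but by defect (c) it is generically UNSATISFIABLE by top-mode explosions of one-ended admissible data
(full early leaves are not in the past development of a one-ended exit slice); the structural repair is R2 (module text). -/
def IsExplosionExitRepaired (𝓑 : StationaryAFBlackHole.{0}) (ν : ℝ) (Y : Type) [TopologicalSpace Y]
    [ChartedSpace E3 Y] [IsManifold (𝓡 3) ∞ Y] [T2Space Y] [SecondCountableTopology Y] [ConnectedSpace Y]
    (e : InitialDataSet (𝓡 3) Y) : Prop :=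
  e ∈ admissibleVacuumData Y ∧
    ∃ 𝒟 : VacuumCauchyDevelopment e, 𝒟.IsMaximal ∧
      ∃ (A : 𝓑.AdaptedChart) (Ψ : A.background.domain → 𝒟.carrier),
        ChartIsAsymptoticallyCartesian A ∧
        ContMDiff 𝓘(ℝ, E4) (𝓡 4) ∞ Ψ ∧ Function.Injective Ψ ∧
          (∀ R : ℝ, ∀ᶠ τ in atBot,
            Ψ '' A.background.truncTimeSlab R τ ⊆
              𝒟.metric.chronologicalPast 𝒟.timeOrientation (Set.range 𝒟.embed)) ∧
          (∃ C : ℝ, ∀ τ : ℝ, τ ≤ 0 →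
            𝒟.toSpacetime.deviationCk A.background Ψ 2 τ ≤
              ENNReal.ofReal (C * Real.exp (ν * τ))) ∧
          ¬ ∃ Ψ' : A.background.domain → 𝒟.carrier,
              ContMDiff 𝓘(ℝ, E4) (𝓡 4) ∞ Ψ' ∧ Function.Injective Ψ' ∧
                (∀ R : ℝ, ∀ᶠ τ in atBot,
                  Ψ' '' A.background.truncTimeSlab R τ ⊆
                    𝒟.metric.chronologicalPast 𝒟.timeOrientation (Set.range 𝒟.embed)) ∧
                ∀ τ : ℝ, τ ≤ 0 → 𝒟.toSpacetime.deviationCk A.background Ψ' 2 τ = 0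

/-- The repair STRENGTHENS the original: (iii*) applied to `Ψ` itself yields a non-zero deviation on some early
leaf, hence (iii). So replacing `IsExplosionExit` by `IsExplosionExitRepaired` in stub 6's conclusion and stub 7's
hypothesis keeps the composition `StationaryLimitReduction_of` type-correct (stub 6 gets harder — its intended
content — and stub 7 finally receives information). [folklore] -/
theorem isExplosionExit_of_repaired {ν : ℝ} (h : IsExplosionExitRepaired 𝓑 ν Y e) :
    IsExplosionExit 𝓑 ν Y e := by
  obtain ⟨he, 𝒟, hmax, A, Ψ, hA, hΨ, hinj, hpast, hrate, hstar⟩ := h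
  refine ⟨he, 𝒟, hmax, A, Ψ, hA, hΨ, hinj, hpast, hrate, ?_⟩
  by_contra hall
  exact hstar ⟨Ψ, hΨ, hinj, hpast, fun τ _ ↦ Classical.byContradiction fun hτ0 ↦ hall ⟨τ, hτ0⟩⟩

omit [T2Space Y] [SecondCountableTopology Y] in
/-- Conversely the junk shape of `isExplosionExit_of_exact_early` is EXCLUDED by the repair: an identification
exact on all early leaves refutes (iii*) for its own chart. [folklore] -/
theorem not_repaired_clause_of_exact (𝒟 : VacuumCauchyDevelopment e) (A : 𝓑.AdaptedChart)
    (Ψ : A.background.domain → 𝒟.carrier) (hΨ : ContMDiff 𝓘(ℝ, E4) (𝓡 4) ∞ Ψ)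
    (hinj : Function.Injective Ψ)
    (hpast : ∀ R : ℝ, ∀ᶠ τ in atBot, Ψ '' A.background.truncTimeSlab R τ ⊆
      𝒟.metric.chronologicalPast 𝒟.timeOrientation (Set.range 𝒟.embed))
    (hexact : ∀ τ : ℝ, τ ≤ 0 → 𝒟.toSpacetime.deviationCk A.background Ψ 2 τ = 0) :
    ¬ ¬ ∃ Ψ' : A.background.domain → 𝒟.carrier,
        ContMDiff 𝓘(ℝ, E4) (𝓡 4) ∞ Ψ' ∧ Function.Injective Ψ' ∧
          (∀ R : ℝ, ∀ᶠ τ in atBot,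
            Ψ' '' A.background.truncTimeSlab R τ ⊆
              𝒟.metric.chronologicalPast 𝒟.timeOrientation (Set.range 𝒟.embed)) ∧
          ∀ τ : ℝ, τ ≤ 0 → 𝒟.toSpacetime.deviationCk A.background Ψ' 2 τ = 0 :=
  not_not_intro ⟨Ψ, hΨ, hinj, hpast, hexact⟩

end Quote

/-! ## §10 Cycle 4 (2026-08-16T05Z): fourth audit of both legs; the proposed REPAIR C′ of stubs 6–7
(drefute gen 2, `NegativeNotes-OneGoodExplosion.md`) typed, related to the original, and attacked BEFORE adoption;
two kernel germs for the lock (stub 7); census.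

### 10.1 Leg (i) re-check — no junk proof of the target either
`KerrOrBomb` binds `[𝓑.metric.HasLeviCivita] [Kerr.Facts]`. Both are THEOREMS of the tree
(`PseudoRiemannianMetric.hasLeviCivita`; `Kerr.Facts` = ⟨`Kerr.isConnected_region_holds`,
`Kerr.contMDiff_bilin_holds`, `Kerr.contMDiff_timeVector_holds`⟩, cf. `Quote.kerrFacts` below), so the instance
binders are dischargeable and NOT contradictory: the target cannot be proved vacuously from an inconsistent
instance hypothesis, and (cycle 1) its telescope is modelled by sub-extremal Kerr (`Kerr.stationaryAFBlackHoleOn`,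
KerrStationaryBlackHole.lean, exists as a term; `InTelescope` of it is print-true, not in tree). The mode-stability
hypothesis is neither vacuous (Whiting) nor junk-refutable: the only cheap growing "modes" of `□_g` on every hole —
the horizon-regular branch, `∝ e^{s v}` at infinity — are unbounded on `doc ∩ I⁻(far slice region)`, because that
region contains `{t* < 0, r → ∞}` where `v = t* + r → ∞`; pure-gauge / zero pairs do not exist for the scalar
equation. Leg (i) stays a genuine open statement (smooth rigidity for mode-stable holes).

### 10.2 Leg (ii) re-check (fourth pass, new items only)
* `IsCauchyHypersurface` quantifies over DIFFERENTIABLE (not piecewise-smooth) timelike curves on order-connected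
  parameter sets without endpoint limits (`IsEndlessTimelikeCurve`): closed or half-closed parameter intervals are
  never endless (`not_isEndlessTimelikeCurve_Icc`, `hasPastEndpoint`-on-`Ici`), a decelerating curve converging in
  `M` is not endless (`not_isFutureEndless_univ_of_tendsto`) — the classical notion; no extra/missing developments,
  so `IsMaximal` (universal receiver over Hausdorff, connected, second-countable carriers) is CBG-faithful.
* Sojourn-form `𝓘⁺` quantifies over ALL normalised null rays from far slice points, ingoing ones included; for a
  black-hole development an ingoing ray from radius `R` enters `J⁺(ι B₀)` at radius `≈ (R+R₀)/2` and reaches `r₊`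
  only after affine time `≈ (R+R₀)/2 − r₊` — independent of the interior (singularity / Cauchy horizon), so the
  clause is satisfiable by every reasonable hole and `B₁ ⊇ X ∖ far` absorbs interior slice points (compact by
  `IsSoleEnd`). `FinalStateDecomposition.diff_subset_causalPast` (the structure's own covering clause, full chart
  images) is satisfied by the exact Schwarzschild exterior above a capped Kruskal slice together with
  `HasExhaustiveCharts` (cycle 3 (5)). No uniform junk failure of `SummitProperty`; `trivialData` is good modulo
  CBG-maximality of Minkowski. NO KILL: `¬ StationaryLimitReduction` remains `KerrOrBomb ∧ ¬ FinalStateConjecture`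
  with both legs out of reach, for the fourth time and by a fourth route.

### 10.3 The repair C′ of stubs 6–7 (drefute gen 2) — typed here (`Quote.ExitCore`, `Quote.IsAFVacuumDataWithEnd`,
`Quote.IsExplosionExit'`, `Quote.GoodFateAlong`), certified to WEAKEN stub 6's conclusion
(`Quote.repaired_of_original`: `IsExplosionExit ∧ SummitProperty → ∃ 𝔢, IsExplosionExit' ∧ GoodFateAlong`, via
`AFEnd.exists_radius_far_disjoint` — any compact `B₁` misses far regions, no sole-end needed), and attacked:
(a) C′ keeps the gauge-dependent non-triviality clause (iii), so the exact-early-wedge junk of T6 transposes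
verbatim (`Quote.exitCore_of_exact_early`, `Quote.isExplosionExit'_of_exact_early`: exact on `τ ≤ 0` + one wiggled
leaf ⇒ exit at EVERY rate); in C′ it is excluded only downstream, through (J), which COSTS the consumer (stub 7′) the
rigidity lemma typed below as `Quote.StationaryGoodFateRigidity` (RIG: a telescope hole admitting an exit
development exactly equal to it on all early leaves with a good fate along some end is `IsKerrExterior`; =
CBG uniqueness on the domain of dependence of a full no-collar leaf + "exactly stationary and `C²`-settling to
sub-extremal Kerr with exhaustive charts ⇒ Kerr", L-sized, believed true, NOT in tree) — `Quote.junk_exit_absurd`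
is the one-line disposal GIVEN RIG. Recommendation to the lead: adopt C′ ∧ R1 (replace (iii) by (iii*) of
`Quote.IsExplosionExitRepaired`) so that stub 6′ owes non-exactness and stub 7′ does not silently contain RIG; or
file RIG as an eighth stub. (b) C′'s sojourn clause along `𝔢` and its decomposition clause are satisfiable by the
explosion's own two-ended slice `Σ₂ = leaf ∪ connector ∪ cylinder {r = r_c}` exactly as the drefuter says: `O =
J⁺(ιΣ₂) ∩ I⁻(charted)` ignores `J⁺(cylinder)` (inside the hole), far ingoing rays have sojourn `≳ R/2` before `r₊`
whatever the perturbed interior does, and (i) holds since early near-horizon slab points reach the cylinder through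
the collar at bounded advanced time. I could not break C′ beyond (a).

### 10.4 Two kernel germs for the lock (stub 7 / 7′; `HasLocalEscape` demands `Function.Injective F`)
* `Quote.flatAmplitude_not_injective`, `Quote.strictMono_oddFlat`, `Quote.injective_lockedCurveParam`: an EVEN flat
  amplitude `s ↦ e^{-1/s²}` alone is not injective (so "even reparametrisation handles both signs" — drefute gen 0 —
  is not enough by itself), while the skeleton's third component `s e^{-1/s²} w₃` restores injectivity for ANY phase
  law `α/s²` (the odd flat function is strictly monotone); with a REAL top rate (`ϖ₁ = 0`, allowed by
  `IsSimpleTopRate`) the two explosions `±ε` are distinct, stub 6 certifies ONE, and the same-sign seed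
  `e^{-1/s²} w₁` on both sides of `s = 0` is exactly what the odd companion makes legal.
* `Quote.flat_seed_swamped` (`e^{-a u² + b u} u^p → 0`, `u = 1/|s|`): a flat seed `e^{-ν₁T₀/s²}`, even after growing
  until the arrival time `≈ 1/|s|` of a signal launched from radius `1/|s|`, is negligible against any polynomially
  small `|s|^p` back-scatter. Consequences for the curve of stub 7: (α) it MUST modify the far field — data with
  receding foci (§7 (b)) settle in `C¹` (`SettlesTo`, `k = 1`) yet are `C²`-bad together with every compactly
  supported modification, so a compact kick alone is never an escape; (β) the modification must lie OUTSIDE the past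
  light cone of the exit event, radius `R(s)` with `R(s) s² → ∞`: a surgery at the customary radius `1/|s|`
  back-scatters a polynomially small signal onto the hole at `t ≈ 1/|s| ≪ T₀/s²`, which swamps the locked seed and
  carries a phase inherited from `D`'s tail — only `(2,1)`-regular in the admissible class, hence not smoothly
  pre-compensable at `s = 0`; the skeleton's `ρ(c) = e^{2/c²}` passes (β) with room, `1/|c|` would not. Both are
  constraints on the PROOF of stub 7 (an `∃ F` statement), not refutations of it.

### 10.5 Why the crux still resists (prose; for the edge of the bomb locus see also §6 note 2)
A finite-dimensional caricature shows what `KerrOrBomb` + per-bomb repulsion do NOT give: `ṡ = −y²`, `ẏ = s·y` has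
the line of equilibria `{y = 0}`, each `(s,0)` with `s > 0` linearly unstable (rate `s`), every single bomb captures
only itself (codimension `≥ 1`, "genericity transfer" holds), yet EVERY off-axis orbit `s² + y² = ρ²` reaches the
degenerate edge `s = 0` in finite time with an `O(ρ)` perturbation (`s = ρ tanh(ρ(t₀−t))`, `y = ρ sech(ρ(t₀−t))`; kernel: `Quote.edge_caricature_orbit`):
open sets of data run to the extremal/degenerate boundary of the bomb family, outside the telescope, where the target
is silent. The crux therefore needs, beyond the target, an EDGE statement (generic third law / no bombs accumulating
at `κ → 0` / outward parameter drift) — in the picked line this is inside `stub_settleOrEscape` (c) through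
`InTelescope` of every limit hole, correctly; it is the same irreducible block every settling route carries.
-/

namespace Quote

/-- `Kerr.Facts` is a tree theorem (so the instance binder of `KerrOrBomb`/`IsKerrExterior` is dischargeable and
consistent; §10.1). [folklore] -/
theorem kerrFacts : Kerr.Facts :=
  ⟨Kerr.isConnected_region_holds, Kerr.contMDiff_bilin_holds, Kerr.contMDiff_timeVector_holds⟩

/-- VERBATIM `OneLockedExplosion.InTelescope` (Lines/one-locked-explosion.lean §0). -/
def InTelescope (𝓑 : StationaryAFBlackHole.{0}) : Prop :=
  haveI : 𝓑.metric.HasLeviCivita := 𝓑.metric.toPseudoRiemannianMetric.hasLeviCivita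
  𝓑.metric.toPseudoRiemannianMetric.IsRicciFlat ∧ IsConnected 𝓑.horizon ∧
    𝓑.toSpacetime.IsNonDegenerateHorizon 𝓑.Mext ∧
      𝓑.metric.IsGloballyHyperbolic 𝓑.timeOrientation ∧ ∀ p ∈ 𝓑.doc, 𝓑.killing p ≠ 0

/-- VERBATIM `OneLockedExplosion.IsKerrExterior` (Lines/one-locked-explosion.lean §0). -/
def IsKerrExterior (𝓑 : StationaryAFBlackHole.{0}) : Prop :=
  haveI : Kerr.Facts := kerrFacts
  ∃ (M a : ℝ), Kerr.IsSubextremal M a ∧ ∃ Ψ : Kerr.exterior M a → 𝓑.carrier,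
    Function.Injective Ψ ∧ Set.range Ψ = 𝓑.doc ∧
      PseudoRiemannianMetric.IsIsometricImmersion
        (Kerr.smoothMetric M a (Kerr.rPlus M a)).toPseudoRiemannianMetric
        𝓑.metric.toPseudoRiemannianMetric Ψ

variable {𝓑 : StationaryAFBlackHole.{0}} {Y : Type} [TopologicalSpace Y] [ChartedSpace E3 Y]
    [IsManifold (𝓡 3) ∞ Y] [T2Space Y] [SecondCountableTopology Y] [ConnectedSpace Y]
    {e : InitialDataSet (𝓡 3) Y}

/-- The chart/development CORE of `IsExplosionExit` — everything after the data clause: an MGHD `𝒟` of `e`, an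
asymptotically Cartesian adapted chart `A` of `𝓑`, a smooth injective `Ψ` with (i) early truncated slabs in
`I⁻(ι Y)`, (ii) whole-leaf `C²` deviation `≤ C e^{ντ}` on `τ ≤ 0`, (iii) some non-zero leaf deviation. The original
and the repaired predicate differ ONLY in the data clause in front of it (`isExplosionExit_iff_core`,
`IsExplosionExit'`). -/
def ExitCore (𝓑 : StationaryAFBlackHole.{0}) (ν : ℝ) (Y : Type) [TopologicalSpace Y] [ChartedSpace E3 Y]
    [IsManifold (𝓡 3) ∞ Y] [T2Space Y] [SecondCountableTopology Y] [ConnectedSpace Y]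
    (e : InitialDataSet (𝓡 3) Y) : Prop :=
  ∃ 𝒟 : VacuumCauchyDevelopment e, 𝒟.IsMaximal ∧
    ∃ (A : 𝓑.AdaptedChart) (Ψ : A.background.domain → 𝒟.carrier),
      ChartIsAsymptoticallyCartesian A ∧
      ContMDiff 𝓘(ℝ, E4) (𝓡 4) ∞ Ψ ∧ Function.Injective Ψ ∧
        (∀ R : ℝ, ∀ᶠ τ in atBot,
          Ψ '' A.background.truncTimeSlab R τ ⊆
            𝒟.metric.chronologicalPast 𝒟.timeOrientation (Set.range 𝒟.embed)) ∧
        (∃ C : ℝ, ∀ τ : ℝ, τ ≤ 0 →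
          𝒟.toSpacetime.deviationCk A.background Ψ 2 τ ≤
            ENNReal.ofReal (C * Real.exp (ν * τ))) ∧
        ∃ τ : ℝ, 𝒟.toSpacetime.deviationCk A.background Ψ 2 τ ≠ 0

/-- The original predicate is "admissible (sole-ended) datum ∧ core" — definitionally. [folklore] -/
theorem isExplosionExit_iff_core {ν : ℝ} :
    IsExplosionExit 𝓑 ν Y e ↔ e ∈ admissibleVacuumData Y ∧ ExitCore 𝓑 ν Y e :=
  Iff.rfl

/-- Drefute gen 2's data clause for the exit datum (C′): smooth complete vacuum data with a CHOSEN strongly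
asymptotically flat end `𝔢` — `admissibleVacuumData` minus `IsSoleEnd` (the end need not be the only one:
the explosion's own slice `leaf ∪ connector ∪ cylinder {r = r_c}` has a second, cylindrical end). -/
def IsAFVacuumDataWithEnd (Y : Type) [TopologicalSpace Y] [ChartedSpace E3 Y] [IsManifold (𝓡 3) ∞ Y]
    (e : InitialDataSet (𝓡 3) Y) (𝔢 : AFEnd Y) : Prop :=
  (∀ [e.metric.HasLeviCivita], e.IsVacuumConstraintSolution ∧ e.IsComplete) ∧
    ∃ M : ℝ, 𝔢.IsStronglyAsymptoticallyFlatDR e M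

/-- **C′, exit half** (`IsExplosionExit'` of NegativeNotes-OneGoodExplosion.md §3, typed): the repaired exit
predicate = the new data clause ∧ the unchanged core. -/
def IsExplosionExit' (𝓑 : StationaryAFBlackHole.{0}) (ν : ℝ) (Y : Type) [TopologicalSpace Y]
    [ChartedSpace E3 Y] [IsManifold (𝓡 3) ∞ Y] [T2Space Y] [SecondCountableTopology Y] [ConnectedSpace Y]
    (e : InitialDataSet (𝓡 3) Y) (𝔢 : AFEnd Y) : Prop :=
  IsAFVacuumDataWithEnd Y e 𝔢 ∧ ExitCore 𝓑 ν Y e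

/-- **C′, fate half** (`GoodFateAlong` of NegativeNotes-OneGoodExplosion.md §3, typed): an MGHD exists, and every
MGHD has complete `𝓘⁺` in the sojourn form READ ALONG THE END `𝔢` (rays from `𝔢.far R₁` instead of from the
complement of a compact set) and carries the summit's exhaustive sub-extremal `C²` Kerr decomposition of its
self-determined exterior (verbatim the second conjunct of `SummitProperty`). -/
def GoodFateAlong (Y : Type) [TopologicalSpace Y] [ChartedSpace E3 Y] [IsManifold (𝓡 3) ∞ Y]
    [T2Space Y] [SecondCountableTopology Y] [ConnectedSpace Y]
    (e : InitialDataSet (𝓡 3) Y) (𝔢 : AFEnd Y) : Prop :=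
  (∃ 𝒟 : VacuumCauchyDevelopment e, 𝒟.IsMaximal) ∧
    ∀ 𝒟 : VacuumCauchyDevelopment e, 𝒟.IsMaximal →
      (∀ [𝒟.metric.HasLeviCivita], ∃ B₀ : Set Y, IsCompact B₀ ∧ ∀ s : ℝ, 0 < s → ∃ R₁ : ℝ,
        ∀ p ∈ 𝔢.far R₁, ∀ (γ : ℝ → 𝒟.carrier) (dom : Set ℝ),
          𝒟.metric.IsNormalisedNullRayFrom 𝒟.timeOrientation 𝒟.embed 𝒟.normal p γ dom →
            ¬ BddAbove dom ∨ ENNReal.ofReal s ≤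
              sojournTime γ dom (𝒟.metric.causalFuture 𝒟.timeOrientation (𝒟.embed '' B₀))) ∧
      ∃ (O : Set 𝒟.carrier) (d : FinalStateDecomposition 𝒟.toSpacetime O 2),
        (∀ i, Kerr.IsSubextremal (d.mass i) (d.spin i)) ∧
          O = Summit.FinalStateConjecture.exteriorOf 𝒟.toCauchyDevelopment d.charted ∧
            Summit.FinalStateConjecture.HasExhaustiveCharts d

omit [T2Space Y] [SecondCountableTopology Y] [ConnectedSpace Y] in
/-- An admissible datum satisfies C′'s data clause along its (sole) admissible end. [folklore] -/
theorem exists_isAFVacuumDataWithEnd_of_mem (he : e ∈ admissibleVacuumData Y) :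
    ∃ 𝔢 : AFEnd Y, 𝔢.IsSoleEnd ∧ IsAFVacuumDataWithEnd Y e 𝔢 := by
  obtain ⟨hvc, 𝔢, M, hsole, hAF⟩ := he
  exact ⟨𝔢, hsole, hvc, M, hAF⟩

/-- The original exit predicate implies the repaired one along the sole end. [folklore] -/
theorem exists_isExplosionExit'_of_isExplosionExit {ν : ℝ} (h : IsExplosionExit 𝓑 ν Y e) :
    ∃ 𝔢 : AFEnd Y, 𝔢.IsSoleEnd ∧ IsExplosionExit' 𝓑 ν Y e 𝔢 := by
  obtain ⟨he, hcore⟩ := h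
  obtain ⟨𝔢, hsole, hdata⟩ := exists_isAFVacuumDataWithEnd_of_mem he
  exact ⟨𝔢, hsole, hdata, hcore⟩

/-- **`SummitProperty` implies `GoodFateAlong` along EVERY end**: the sojourn clause "for rays from the complement
of a compact `B₁`" implies the clause "for rays from `𝔢.far R₁`", because a compact set misses all sufficiently far
regions of any asymptotically flat end (`AFEnd.exists_radius_far_disjoint` — closedness at infinity; no sole-end
hypothesis is used). [folklore] -/
theorem goodFateAlong_of_summitProperty (𝔢 : AFEnd Y) (h : SummitProperty Y e) : GoodFateAlong Y e 𝔢 := by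
  refine ⟨h.1, fun 𝒟 hmax ↦ ⟨?_, (h.2 𝒟 hmax).2⟩⟩
  intro _inst
  obtain ⟨B₀, hB₀, hs⟩ := (h.2 𝒟 hmax).1
  refine ⟨B₀, hB₀, fun s hs' ↦ ?_⟩
  obtain ⟨B₁, hB₁, hray⟩ := hs s hs'
  obtain ⟨R₁, -, hdisj⟩ := 𝔢.exists_radius_far_disjoint hB₁
  exact ⟨R₁, fun p hp γ dom hγ ↦ hray p (Set.disjoint_left.1 (hdisj R₁ le_rfl) hp) γ dom hγ⟩

/-- **C′ WEAKENS stub 6's conclusion** (kernel certificate for the reshape): the original conjunction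
`IsExplosionExit ∧ SummitProperty` implies the repaired `∃ 𝔢, IsExplosionExit' ∧ GoodFateAlong` (along the sole
end). Hence replacing the former by the latter in stub 6's conclusion and stub 7's hypothesis keeps the composition
type-correct, makes stub 6 weaker (its intended content) and stub 7 correspondingly stronger. [folklore] -/
theorem repaired_of_original {ν : ℝ} (h : IsExplosionExit 𝓑 ν Y e ∧ SummitProperty Y e) :
    ∃ 𝔢 : AFEnd Y, IsExplosionExit' 𝓑 ν Y e 𝔢 ∧ GoodFateAlong Y e 𝔢 := by
  obtain ⟨𝔢, -, hexit⟩ := exists_isExplosionExit'_of_isExplosionExit h.1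
  exact ⟨𝔢, hexit, goodFateAlong_of_summitProperty 𝔢 h.2⟩

/-- **The exact-early-wedge junk lives in the CORE** (T6 (a)/(b) transposed; the cycle-3 proof never touched the
data clause): exact on every early leaf + one non-zero (late or gauge-wiggled) leaf ⇒ core at EVERY rate.
[folklore] -/
theorem exitCore_of_exact_early (𝒟 : VacuumCauchyDevelopment e) (hmax : 𝒟.IsMaximal) (A : 𝓑.AdaptedChart)
    (Ψ : A.background.domain → 𝒟.carrier) (hA : ChartIsAsymptoticallyCartesian A)
    (hΨ : ContMDiff 𝓘(ℝ, E4) (𝓡 4) ∞ Ψ) (hinj : Function.Injective Ψ)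
    (hpast : ∀ R : ℝ, ∀ᶠ τ in atBot, Ψ '' A.background.truncTimeSlab R τ ⊆
      𝒟.metric.chronologicalPast 𝒟.timeOrientation (Set.range 𝒟.embed))
    (hexact : ∀ τ : ℝ, τ ≤ 0 → 𝒟.toSpacetime.deviationCk A.background Ψ 2 τ = 0)
    (hne : ∃ τ : ℝ, 𝒟.toSpacetime.deviationCk A.background Ψ 2 τ ≠ 0) (ν : ℝ) :
    ExitCore 𝓑 ν Y e :=
  ⟨𝒟, hmax, A, Ψ, hA, hΨ, hinj, hpast, ⟨0, fun τ hτ ↦ by rw [hexact τ hτ]; exact bot_le⟩, hne⟩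

/-- … hence C′'s exit predicate is satisfied at EVERY rate by an exit development that is EXACTLY `𝓑` on all early
leaves (defect (a)/(b) of T6 persists in C′; it is excluded only downstream through (J), i.e. through
`StationaryGoodFateRigidity`). [folklore] -/
theorem isExplosionExit'_of_exact_early {𝔢 : AFEnd Y} (hdata : IsAFVacuumDataWithEnd Y e 𝔢)
    (𝒟 : VacuumCauchyDevelopment e) (hmax : 𝒟.IsMaximal) (A : 𝓑.AdaptedChart)
    (Ψ : A.background.domain → 𝒟.carrier) (hA : ChartIsAsymptoticallyCartesian A)
    (hΨ : ContMDiff 𝓘(ℝ, E4) (𝓡 4) ∞ Ψ) (hinj : Function.Injective Ψ)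
    (hpast : ∀ R : ℝ, ∀ᶠ τ in atBot, Ψ '' A.background.truncTimeSlab R τ ⊆
      𝒟.metric.chronologicalPast 𝒟.timeOrientation (Set.range 𝒟.embed))
    (hexact : ∀ τ : ℝ, τ ≤ 0 → 𝒟.toSpacetime.deviationCk A.background Ψ 2 τ = 0)
    (hne : ∃ τ : ℝ, 𝒟.toSpacetime.deviationCk A.background Ψ 2 τ ≠ 0) (ν : ℝ) :
    IsExplosionExit' 𝓑 ν Y e 𝔢 :=
  ⟨hdata, exitCore_of_exact_early 𝒟 hmax A Ψ hA hΨ hinj hpast hexact hne ν⟩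

/-- **RIG — the rigidity lemma the consumer of C′ owes if clause (iii) is kept** (typed proposal; NOT claimed, NOT
in tree; = CBG uniqueness on the domain of dependence of a full no-collar leaf + "an exactly stationary exterior that
settles in `C²` to sub-extremal Kerr with exhaustive charts is a Kerr exterior"): a telescope hole `𝓑` which admits
an exit datum with a good fate along some end whose MGHD is EXACTLY `𝓑` on all early leaves of an asymptotically
Cartesian adapted chart is `IsKerrExterior`. -/
def StationaryGoodFateRigidity : Prop :=
  ∀ (𝓑 : StationaryAFBlackHole.{0}) (Y : Type) [TopologicalSpace Y] [ChartedSpace E3 Y]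
    [IsManifold (𝓡 3) ∞ Y] [T2Space Y] [SecondCountableTopology Y] [ConnectedSpace Y]
    (e : InitialDataSet (𝓡 3) Y) (𝔢 : AFEnd Y),
    InTelescope 𝓑 → GoodFateAlong Y e 𝔢 →
      (∃ 𝒟 : VacuumCauchyDevelopment e, 𝒟.IsMaximal ∧
        ∃ (A : 𝓑.AdaptedChart) (Ψ : A.background.domain → 𝒟.carrier),
          ChartIsAsymptoticallyCartesian A ∧ ContMDiff 𝓘(ℝ, E4) (𝓡 4) ∞ Ψ ∧ Function.Injective Ψ ∧
            (∀ R : ℝ, ∀ᶠ τ in atBot, Ψ '' A.background.truncTimeSlab R τ ⊆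
              𝒟.metric.chronologicalPast 𝒟.timeOrientation (Set.range 𝒟.embed)) ∧
            ∀ τ : ℝ, τ ≤ 0 → 𝒟.toSpacetime.deviationCk A.background Ψ 2 τ = 0) →
      IsKerrExterior 𝓑

/-- **Disposal of the junk GIVEN RIG** (what stub 7′ must do with an exact-wedge input when stub 6′ ranges over
non-Kerr holes): an exit development exactly `𝓑` on all early leaves with a good fate contradicts
`¬ IsKerrExterior 𝓑`. One line — all the content is in RIG. [folklore] -/
theorem junk_exit_absurd (hRIG : StationaryGoodFateRigidity) (hT : InTelescope 𝓑) (hnK : ¬ IsKerrExterior 𝓑)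
    {𝔢 : AFEnd Y} (hfate : GoodFateAlong Y e 𝔢) (𝒟 : VacuumCauchyDevelopment e) (hmax : 𝒟.IsMaximal)
    (A : 𝓑.AdaptedChart) (Ψ : A.background.domain → 𝒟.carrier) (hA : ChartIsAsymptoticallyCartesian A)
    (hΨ : ContMDiff 𝓘(ℝ, E4) (𝓡 4) ∞ Ψ) (hinj : Function.Injective Ψ)
    (hpast : ∀ R : ℝ, ∀ᶠ τ in atBot, Ψ '' A.background.truncTimeSlab R τ ⊆
      𝒟.metric.chronologicalPast 𝒟.timeOrientation (Set.range 𝒟.embed))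
    (hexact : ∀ τ : ℝ, τ ≤ 0 → 𝒟.toSpacetime.deviationCk A.background Ψ 2 τ = 0) : False :=
  hnK (hRIG 𝓑 Y e 𝔢 hT hfate ⟨𝒟, hmax, A, Ψ, hA, hΨ, hinj, hpast, hexact⟩)

/-! ### 10.4 kernel germs for the lock -/

/-- An EVEN flat amplitude `s ↦ e^{-1/s²}` (`expNegInvGlue (s²)`) is not injective: an escape curve built on it
alone violates `Function.Injective F` of `HasLocalEscape`/`IsChristodoulouGeneric`. [folklore] -/
theorem flatAmplitude_not_injective : ¬ Function.Injective (fun s : ℝ ↦ expNegInvGlue (s ^ 2)) := by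
  intro h
  have h1 : (fun s : ℝ ↦ expNegInvGlue (s ^ 2)) 1 = (fun s : ℝ ↦ expNegInvGlue (s ^ 2)) (-1) := by
    norm_num
  have := h h1
  norm_num at this

/-- The ODD flat companion `s ↦ s·e^{-1/s²}` is strictly monotone (hence injective): the skeleton's third kick
component `s e^{-1/s²} w₃` is what makes the phase-locked curve injective, for any phase law. [folklore] -/
theorem strictMono_oddFlat : StrictMono (fun s : ℝ ↦ s * expNegInvGlue (s ^ 2)) := by
  -- positive half-line first
  have hpos : ∀ s t : ℝ, 0 ≤ s → s < t → s * expNegInvGlue (s ^ 2) < t * expNegInvGlue (t ^ 2) := by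
    intro s t hs hst
    have ht : 0 < t := hs.trans_lt hst
    have hgt : 0 < expNegInvGlue (t ^ 2) := expNegInvGlue.pos_of_pos (by positivity)
    have hmono : expNegInvGlue (s ^ 2) ≤ expNegInvGlue (t ^ 2) :=
      expNegInvGlue.monotone (by nlinarith)
    calc s * expNegInvGlue (s ^ 2) ≤ s * expNegInvGlue (t ^ 2) :=
          mul_le_mul_of_nonneg_left hmono hs
      _ < t * expNegInvGlue (t ^ 2) := mul_lt_mul_of_pos_right hst hgt
  intro s t hst
  rcases le_or_gt 0 s with hs | hs
  · exact hpos s t hs hst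
  · -- `s < 0`
    rcases le_or_gt t 0 with ht | ht
    · -- `s < t ≤ 0`: reflect
      have h := hpos (-t) (-s) (by linarith) (by linarith)
      have e1 : (-t) ^ 2 = t ^ 2 := by ring
      have e2 : (-s) ^ 2 = s ^ 2 := by ring
      rw [e1, e2] at h
      linarith
    · -- `s < 0 < t`
      have hgs : 0 < expNegInvGlue (s ^ 2) := expNegInvGlue.pos_of_pos (by nlinarith)
      have hgt : 0 < expNegInvGlue (t ^ 2) := expNegInvGlue.pos_of_pos (by positivity)
      have h1 : s * expNegInvGlue (s ^ 2) < 0 := mul_neg_of_neg_of_pos hs hgs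
      have h2 : 0 < t * expNegInvGlue (t ^ 2) := mul_pos ht hgt
      exact h1.trans h2

/-- The odd flat companion is smooth. [folklore] -/
theorem contDiff_oddFlat : ContDiff ℝ ∞ (fun s : ℝ ↦ s * expNegInvGlue (s ^ 2)) :=
  contDiff_id.mul (expNegInvGlue.contDiff.comp (contDiff_id.pow 2))

/-- **The skeleton's locked curve parameter is injective for every phase law**: `s ↦ (e^{-1/s²} cos(α/s²),
e^{-1/s²} sin(α/s²), s e^{-1/s²})` is injective (third component), so `F s = D ⊕ (these coefficients on
w₁, w₂, w₃)` is injective as soon as `w₃` is read off linearly independently of `w₁, w₂`. [folklore] -/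
theorem injective_lockedCurveParam (α : ℝ) :
    Function.Injective (fun s : ℝ ↦ (expNegInvGlue (s ^ 2) * Real.cos (α / s ^ 2),
      expNegInvGlue (s ^ 2) * Real.sin (α / s ^ 2), s * expNegInvGlue (s ^ 2))) := by
  intro s t h
  have h3 := congrArg (fun q : ℝ × ℝ × ℝ ↦ q.2.2) h
  exact strictMono_oddFlat.injective h3

/-- **A flat seed is swamped by any polynomial signal arriving before the exit** (`u = 1/|s| → ∞`; seed
`e^{-a u²}` with `a = ν₁T₀`, grown by `e^{b u}` up to the arrival time `≈ u` of a signal launched from radius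
`1/|s|`, against a back-scatter of size `|s|^p = u^{-p}`): `e^{-a u² + b u} u^p → 0`. So far-field modifications
along the lock curve must sit outside the past light cone of the exit event (`R(s) s² → ∞`). [folklore] -/
theorem flat_seed_swamped {a : ℝ} (ha : 0 < a) (b p : ℝ) :
    Tendsto (fun u : ℝ ↦ Real.exp (-a * u ^ 2 + b * u) * u ^ p) atTop (𝓝 0) := by
  set c : ℝ := b + |p| with hc
  -- the comparison exponent tends to `-∞`
  have h1 : Tendsto (fun u : ℝ ↦ -a * u ^ 2 + c * u) atTop atBot := by
    have e : (fun u : ℝ ↦ -a * u ^ 2 + c * u) = fun u ↦ u * (c + -(a * u)) := by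
      funext u; ring
    rw [e]
    refine Filter.Tendsto.atTop_mul_atBot₀ tendsto_id ?_
    exact tendsto_atBot_add_const_left _ c
      (tendsto_neg_atTop_atBot.comp (tendsto_id.const_mul_atTop ha))
  have h2 : Tendsto (fun u : ℝ ↦ Real.exp (-a * u ^ 2 + c * u)) atTop (𝓝 0) :=
    Real.tendsto_exp_atBot.comp h1
  refine squeeze_zero_norm' ?_ h2
  filter_upwards [eventually_ge_atTop (1 : ℝ)] with u hu
  have hu0 : 0 < u := by linarith
  have hlog : 0 ≤ Real.log u := Real.log_nonneg hu
  have hlogle : Real.log u ≤ u := (Real.log_le_sub_one_of_pos hu0).trans (by linarith)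
  rw [Real.norm_eq_abs, abs_mul, Real.abs_exp, Real.abs_rpow_of_nonneg hu0.le, abs_of_pos hu0,
    Real.rpow_def_of_pos hu0, ← Real.exp_add]
  refine Real.exp_le_exp.2 ?_
  have : Real.log u * p ≤ |p| * u := by
    calc Real.log u * p ≤ Real.log u * |p| := mul_le_mul_of_nonneg_left (le_abs_self p) hlog
      _ = |p| * Real.log u := by ring
      _ ≤ |p| * u := mul_le_mul_of_nonneg_left hlogle (abs_nonneg p)
  rw [hc]
  nlinarith

/-- **§10.5 caricature, kernel-checked** (small model for "target + per-bomb repulsion ⇏ generic settling"). The planar system `ṡ = −y²`, `ẏ = s·y` (equilibria: the axis `{y = 0}`;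
linearisation at `(σ, 0)` = `diag(0, σ)`, unstable for `σ > 0`) has the explicit orbits
`s = ρ tanh(ρ(t₀ − t))`, `y = ρ sech(ρ(t₀ − t))`: every such orbit has `s > 0` before `t₀` and reaches the
degenerate edge `s = 0` AT time `t₀` with `y = ρ` — so "every non-degenerate equilibrium is unstable and captures only a
codimension-`≥ 1` set" coexists with "every off-axis orbit runs to the degenerate edge": the crux needs an EDGE statement
(generic third law) beyond `KerrOrBomb`. [folklore] -/
theorem edge_caricature_orbit (ρ t₀ : ℝ) :
    (∀ t, HasDerivAt (fun t ↦ ρ * Real.sinh (ρ * (t₀ - t)) / Real.cosh (ρ * (t₀ - t)))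
        (-(ρ / Real.cosh (ρ * (t₀ - t))) ^ 2) t) ∧
    (∀ t, HasDerivAt (fun t ↦ ρ / Real.cosh (ρ * (t₀ - t)))
        ((ρ * Real.sinh (ρ * (t₀ - t)) / Real.cosh (ρ * (t₀ - t))) * (ρ / Real.cosh (ρ * (t₀ - t)))) t) ∧
    ρ * Real.sinh (ρ * (t₀ - t₀)) / Real.cosh (ρ * (t₀ - t₀)) = 0 ∧ ρ / Real.cosh (ρ * (t₀ - t₀)) = ρ ∧
    (0 < ρ → ∀ t < t₀, 0 < ρ * Real.sinh (ρ * (t₀ - t)) / Real.cosh (ρ * (t₀ - t))) := by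
  have hx : ∀ t, HasDerivAt (fun t ↦ ρ * (t₀ - t)) (ρ * -1) t := fun t ↦
    ((hasDerivAt_id t).const_sub t₀).const_mul ρ
  have hsinh : ∀ t, HasDerivAt (fun t ↦ Real.sinh (ρ * (t₀ - t)))
      (Real.cosh (ρ * (t₀ - t)) * (ρ * -1)) t := fun t ↦ (hx t).sinh
  have hcosh : ∀ t, HasDerivAt (fun t ↦ Real.cosh (ρ * (t₀ - t)))
      (Real.sinh (ρ * (t₀ - t)) * (ρ * -1)) t := fun t ↦ (hx t).cosh
  refine ⟨fun t ↦ ?_, fun t ↦ ?_, by simp, by simp, fun hρ t ht ↦ ?_⟩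
  · have hc : Real.cosh (ρ * (t₀ - t)) ≠ 0 := (Real.cosh_pos _).ne'
    have h := ((hsinh t).const_mul ρ).div (hcosh t) hc
    have hid := Real.cosh_sq_sub_sinh_sq (ρ * (t₀ - t))
    refine h.congr_deriv ?_
    rw [div_pow, div_eq_iff (pow_ne_zero 2 hc), neg_mul, div_mul_cancel₀ _ (pow_ne_zero 2 hc)]
    linear_combination (-ρ ^ 2) * hid
  · have hc : Real.cosh (ρ * (t₀ - t)) ≠ 0 := (Real.cosh_pos _).ne'
    have h := (hasDerivAt_const t ρ).div (hcosh t) hc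
    refine h.congr_deriv ?_
    rw [div_mul_div_comm, div_eq_div_iff (pow_ne_zero 2 hc) (mul_ne_zero hc hc)]
    ring
  · have h1 : 0 < ρ * (t₀ - t) := mul_pos hρ (by linarith)
    have h2 : 0 < Real.sinh (ρ * (t₀ - t)) := Real.sinh_pos_iff.2 h1
    have h3 : 0 < Real.cosh (ρ * (t₀ - t)) := Real.cosh_pos _
    positivity

end Quote

end Summit.FinalStateConjecture.FinalStateConjecture.Cruxes.StationaryLimitReduction.Disproof
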